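import Literature.Analysis.FluidPDE.Tao2016AveragedNS.SplitCascadeRescaled
import Literature.Analysis.ODE.LinearComparison
import Mathlib.Analysis.SpecialFunctions.Pow.Real
import Mathlib.Analysis.SpecialFunctions.Sqrt
import HarnessLib

/-!
# The split Prop. 6.5: the mode equations at scales `-1, 0, 1` with explicit errors (layer 1 of the §6.5–6.7 port)

T. Tao, *Finite time blowup for an averaged three-dimensional Navier–Stokes equation*,
J. Amer. Math. Soc. **29** (2016), 601–674 = arXiv:1402.0290v3, §6.4 (6.45)–(6.49), §6.6
(6.129)–(6.137), §6.7 (6.177). HONEST FRAMING: statements about the SPLIT cascade model system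
(the cell harvest/h2-tao-ladder's square-free doubling `C♯` of Tao's table, rescaled hypotheses
`RescaledSplitHypotheses` of `SplitCascadeRescaled.lean`); nothing here proves the split Prop. 6.5
(`rescaledSplitStepWith`), and nothing here concerns the true Navier–Stokes equations.

## What this file is

The tree proves Tao's Prop. 6.5 (`TaoCascade.rescaledStepCorrected'_holds`) by a bootstrap
(files `TaoCascadeRescaledEnergy/…Bootstrap/…FiveModes/…FineModes/…CoarseModes/…ScaleOne*/
…ZeroScale*/…ReducedClaim*`) every theorem of which takes `h : TaoCascade.RescaledHypotheses …`.
That structure is RIGID in exactly the places where the split system differs from Tao's — the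
errors of (6.45)–(6.48) are `∝ √Ẽ_k` while the split `a_k`-row carries the cross-shell pump
correction `-K Λ^{5k/2} Z̃_{d,k-1}²`; the energy inequality (6.49) is exact while the split fluxes are
`K(d̃² - Z̃_d²)ã`; (6.51) has no room for `½ΣZ̃²` over the long rescaled past — so no choice of
`(τ, Y, F)` built from split data satisfies `RescaledHypotheses`, and the tree's step cannot be
invoked as a black box. Its PROOF, however, consumes (6.45)–(6.48) only at the three scales
`k ∈ {-1, 0, 1}` and only through the explicit-error lemmas of `TaoCascadeFiveModes.lean`
((6.129)–(6.133)), `TaoCascadeFineModes.lean` (scale `1`) and `TaoCascadeCoarseModes.lean`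
((6.134)–(6.137), (6.177)), plus the energy API of `TaoCascadeRescaledEnergy.lean`.

This file is the split counterpart of exactly that layer: the same lemmas, with the same names
under `RescaledSplitHypotheses`, their right-hand sides augmented by the EXPLICIT asymmetry terms
(`W = (Z̃_a, Z̃_c, Z̃_d)`): either kept exact (scale `1`, where the tree integrates the equations over
the whole rescaled past and bounds everything by energies), or bounded by a pointwise asymmetry
bound `|W_{i,k}(t)| ≤ ζ` supplied as a hypothesis (scales `0`, `±1` inside the bootstrap window,
where the asymmetry is `n₀`-small by the profile clauses and the channel lemmas of
`SplitCascadeChannels.lean`), or bounded by energies where Tao's own argument already does so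
(every hand-off flux `K(d̃²_{k-1} - Z̃²_{d,k-1})` that the tree bounds by `2KẼ_{k-1}`). The extra terms
are, scale by scale: (6.129♯) `+ ε⁻²ζ²`; (6.130♯) `+ (ε + ε⁻¹K¹⁰)ζ²`; (6.131♯) `+ ε²e^{-K¹⁰}ζ²`;
(6.132♯) `+ ε⁻²ζ²`; (6.133♯) `+ (1+ε₀)^{5/2}(ε⁻²ζ₁² + Kζ₀²)`; (6.49♯ at scale 0)
`+ (1+ε₀)^{5/2}Kζ₀²|ã₁|`; (6.134♯)/(6.137♯) `+ (1+ε₀)^{-5/2}ε⁻²ζ²`; (6.135♯) `+ (1+ε₀)^{-5/2}(ε+ε⁻¹K¹⁰)ζ²`;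
(6.136♯) `+ (1+ε₀)^{-5/2}ε²e^{-K¹⁰}ζ²`; (6.177♯) `+ Kζ²√(2E₁)`. Also recorded: the asymmetry rows
(6.Z1)–(6.Z3) at scales `-1, 0, 1` with explicit errors (inputs of the channel lemmas), and the
basic energy API (`Ỹ_i² ≤ 2F`, `W_i² ≤ 2F`, `|d̃² - Z̃_d²| ≤ 2F`).

## References

* T. Tao, J. Amer. Math. Soc. 29 (2016), 601–674 = arXiv:1402.0290v3, §6.4 Prop. 6.5
  (6.43)–(6.66), §6.6 (6.129)–(6.137), §6.7 (6.177). [`Tao2016AveragedNS`]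
-/

noncomputable section

open Set MeasureTheory
open Literature.Analysis.ODE

namespace Literature.Analysis.FluidPDE.Tao2016AveragedNS

open TaoCascade

section Basic

variable {γ ε₀ K ε C₁ C₂ C₃ : ℝ} {n₀ N : ℤ} {η : ℤ → ℝ} {β : ℕ → ℝ} {τ : ℤ → ℝ}
  {Y : Fin 4 → ℤ → ℝ → ℝ} {W : Fin 3 → ℤ → ℝ → ℝ} {F : ℤ → ℝ → ℝ}

/-! ## Basic API of the split hypotheses -/

/-- The initial rescaled time is `≤ 0 = τ_0`. [cite: Tao2016AveragedNS, §6.4 Prop. 6.5 (vii)] -/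
theorem RescaledSplitHypotheses.tau_init_le
    (h : RescaledSplitHypotheses γ ε₀ K ε C₁ C₂ C₃ n₀ N η β τ Y W F) (hN : n₀ ≤ N) :
    τ (n₀ - N) ≤ 0 :=
  h.tau_le _ le_rfl (by omega)

/-- The rescaled times are monotone on `[n₀-N, 0]`. [cite: Tao2016AveragedNS, §6.4 Prop. 6.5] -/
theorem RescaledSplitHypotheses.tau_mono
    (h : RescaledSplitHypotheses γ ε₀ K ε C₁ C₂ C₃ n₀ N η β τ Y W F) {j k : ℤ}
    (hj : n₀ - N ≤ j) (hjk : j ≤ k) (hk : k ≤ 0) : τ j ≤ τ k := by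
  induction k, hjk using Int.leInduction with
  | base => exact le_rfl
  | succ k hjk' ih =>
    have hlt := h.tau_lt (k + 1) (by omega) hk
    simp only [add_sub_cancel_right] at hlt
    exact (ih (by omega)).trans hlt.le

/-- `τ_{n₀-N} ≤ τ_k` for `n₀ - N ≤ k ≤ 0`. [cite: Tao2016AveragedNS, §6.4 Prop. 6.5] -/
theorem RescaledSplitHypotheses.tau_init_le_tau
    (h : RescaledSplitHypotheses γ ε₀ K ε C₁ C₂ C₃ n₀ N η β τ Y W F) {k : ℤ}
    (hk1 : n₀ - N ≤ k) (hk2 : k ≤ 0) : τ (n₀ - N) ≤ τ k :=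
  h.tau_mono le_rfl hk1 hk2

/-- The symmetric amplitudes are controlled by the energy: `Ỹ_i² ≤ 2 Ẽ_k` ((6.51♯), lower bound).
[cite: Tao2016AveragedNS, §6.4 Prop. 6.5 (iv)] -/
theorem RescaledSplitHypotheses.sq_le_two_mul_energy
    (h : RescaledSplitHypotheses γ ε₀ K ε C₁ C₂ C₃ n₀ N η β τ Y W F) (i : Fin 4) (k : ℤ) {t : ℝ}
    (ht : τ (n₀ - N) ≤ t) : Y i k t ^ 2 ≤ 2 * F k t := by
  have hd := h.defect_lower k t ht
  have hsum : Y i k t ^ 2 ≤ ∑ j, Y j k t ^ 2 := by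
    rw [Fin.sum_univ_four]
    fin_cases i <;> simp <;> nlinarith [sq_nonneg (Y 0 k t), sq_nonneg (Y 1 k t),
      sq_nonneg (Y 2 k t), sq_nonneg (Y 3 k t)]
  have hW : 0 ≤ ∑ j, W j k t ^ 2 := Finset.sum_nonneg fun j _ => sq_nonneg _
  linarith

/-- The asymmetries are controlled by the energy: `W_i² ≤ 2 Ẽ_k` ((6.51♯), lower bound).
[cite: Tao2016AveragedNS, §6.4 Prop. 6.5 (iv)] -/
theorem RescaledSplitHypotheses.sqW_le_two_mul_energy
    (h : RescaledSplitHypotheses γ ε₀ K ε C₁ C₂ C₃ n₀ N η β τ Y W F) (i : Fin 3) (k : ℤ) {t : ℝ}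
    (ht : τ (n₀ - N) ≤ t) : W i k t ^ 2 ≤ 2 * F k t := by
  have hd := h.defect_lower k t ht
  have hsum : W i k t ^ 2 ≤ ∑ j, W j k t ^ 2 := by
    rw [Fin.sum_univ_three]
    fin_cases i <;> simp <;> nlinarith [sq_nonneg (W 0 k t), sq_nonneg (W 1 k t),
      sq_nonneg (W 2 k t)]
  have hY : 0 ≤ ∑ j, Y j k t ^ 2 := Finset.sum_nonneg fun j _ => sq_nonneg _
  linarith

/-- A symmetric amplitude and an asymmetry of the same scale together: `Ỹ_i² + W_j² ≤ 2 Ẽ_k`.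
[cite: Tao2016AveragedNS, §6.4 Prop. 6.5 (iv)] -/
theorem RescaledSplitHypotheses.sq_add_sqW_le_two_mul_energy
    (h : RescaledSplitHypotheses γ ε₀ K ε C₁ C₂ C₃ n₀ N η β τ Y W F) (i : Fin 4) (j : Fin 3)
    (k : ℤ) {t : ℝ} (ht : τ (n₀ - N) ≤ t) : Y i k t ^ 2 + W j k t ^ 2 ≤ 2 * F k t := by
  have hd := h.defect_lower k t ht
  have hY : Y i k t ^ 2 ≤ ∑ l, Y l k t ^ 2 := by
    rw [Fin.sum_univ_four]
    fin_cases i <;> simp <;> nlinarith [sq_nonneg (Y 0 k t), sq_nonneg (Y 1 k t),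
      sq_nonneg (Y 2 k t), sq_nonneg (Y 3 k t)]
  have hW : W j k t ^ 2 ≤ ∑ l, W l k t ^ 2 := by
    rw [Fin.sum_univ_three]
    fin_cases j <;> simp <;> nlinarith [sq_nonneg (W 0 k t), sq_nonneg (W 1 k t),
      sq_nonneg (W 2 k t)]
  linarith

/-- `|Ỹ_i| ≤ (2 Ẽ_k)^{1/2}`. [cite: Tao2016AveragedNS, §6.4 Prop. 6.5 (iv)] -/
theorem RescaledSplitHypotheses.abs_le_sqrt_energy
    (h : RescaledSplitHypotheses γ ε₀ K ε C₁ C₂ C₃ n₀ N η β τ Y W F) (i : Fin 4) (k : ℤ) {t : ℝ}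
    (ht : τ (n₀ - N) ≤ t) : |Y i k t| ≤ Real.sqrt (2 * F k t) := by
  rw [← Real.sqrt_sq_eq_abs]
  exact Real.sqrt_le_sqrt (h.sq_le_two_mul_energy i k ht)

/-- `|W_i| ≤ (2 Ẽ_k)^{1/2}`. [cite: Tao2016AveragedNS, §6.4 Prop. 6.5 (iv)] -/
theorem RescaledSplitHypotheses.absW_le_sqrt_energy
    (h : RescaledSplitHypotheses γ ε₀ K ε C₁ C₂ C₃ n₀ N η β τ Y W F) (i : Fin 3) (k : ℤ) {t : ℝ}
    (ht : τ (n₀ - N) ≤ t) : |W i k t| ≤ Real.sqrt (2 * F k t) := by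
  rw [← Real.sqrt_sq_eq_abs]
  exact Real.sqrt_le_sqrt (h.sqW_le_two_mul_energy i k ht)

/-- `|Ỹ_i| ≤ B` whenever `2 Ẽ_k ≤ B²` and `B ≥ 0`. [cite: Tao2016AveragedNS, §6.4 Prop. 6.5 (iv)] -/
theorem RescaledSplitHypotheses.abs_le_of_energy_le
    (h : RescaledSplitHypotheses γ ε₀ K ε C₁ C₂ C₃ n₀ N η β τ Y W F) (i : Fin 4) (k : ℤ) {t B : ℝ}
    (ht : τ (n₀ - N) ≤ t) (hB : 0 ≤ B) (hE : 2 * F k t ≤ B ^ 2) : |Y i k t| ≤ B :=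
  abs_le.mpr (abs_le_of_sq_le_sq' ((h.sq_le_two_mul_energy i k ht).trans hE) hB)

/-- `|W_i| ≤ B` whenever `2 Ẽ_k ≤ B²` and `B ≥ 0`. [cite: Tao2016AveragedNS, §6.4 Prop. 6.5 (iv)] -/
theorem RescaledSplitHypotheses.absW_le_of_energy_le
    (h : RescaledSplitHypotheses γ ε₀ K ε C₁ C₂ C₃ n₀ N η β τ Y W F) (i : Fin 3) (k : ℤ) {t B : ℝ}
    (ht : τ (n₀ - N) ≤ t) (hB : 0 ≤ B) (hE : 2 * F k t ≤ B ^ 2) : |W i k t| ≤ B :=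
  abs_le.mpr (abs_le_of_sq_le_sq' ((h.sqW_le_two_mul_energy i k ht).trans hE) hB)

/-- Products of two symmetric amplitudes of the same scale are bounded by twice the energy:
`|Ỹ_i Ỹ_j| ≤ 2 Ẽ_k`. [cite: Tao2016AveragedNS, §6.4 Prop. 6.5 (iv)] -/
theorem RescaledSplitHypotheses.abs_mul_le_two_mul_energy
    (h : RescaledSplitHypotheses γ ε₀ K ε C₁ C₂ C₃ n₀ N η β τ Y W F) (i j : Fin 4) (k : ℤ) {t : ℝ}
    (ht : τ (n₀ - N) ≤ t) : |Y i k t * Y j k t| ≤ 2 * F k t := by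
  have hi := h.sq_le_two_mul_energy i k ht
  have hj := h.sq_le_two_mul_energy j k ht
  rw [abs_mul]
  nlinarith [sq_abs (Y i k t), sq_abs (Y j k t), sq_nonneg (|Y i k t| - |Y j k t|),
    abs_nonneg (Y i k t), abs_nonneg (Y j k t)]

/-- Products of two asymmetries of the same scale are bounded by twice the energy:
`|W_i W_j| ≤ 2 Ẽ_k`. [cite: Tao2016AveragedNS, §6.4 Prop. 6.5 (iv)] -/
theorem RescaledSplitHypotheses.absW_mul_le_two_mul_energy
    (h : RescaledSplitHypotheses γ ε₀ K ε C₁ C₂ C₃ n₀ N η β τ Y W F) (i j : Fin 3) (k : ℤ) {t : ℝ}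
    (ht : τ (n₀ - N) ≤ t) : |W i k t * W j k t| ≤ 2 * F k t := by
  have hi := h.sqW_le_two_mul_energy i k ht
  have hj := h.sqW_le_two_mul_energy j k ht
  rw [abs_mul]
  nlinarith [sq_abs (W i k t), sq_abs (W j k t), sq_nonneg (|W i k t| - |W j k t|),
    abs_nonneg (W i k t), abs_nonneg (W j k t)]

/-- The two-way hand-off factor is bounded by the energy: `|d̃_k² - Z̃_{d,k}²| ≤ 2 Ẽ_k` — the bound
by which every hand-off term of the split system that Tao's proof bounds by energies
(`K d²_{-2}`, `K d²_{-1} a₀`, …) is bounded by the SAME constant. [cite: Tao2016AveragedNS, §6.4 Prop. 6.5 (iv)] -/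
theorem RescaledSplitHypotheses.abs_sq_sub_sqW_le_two_mul_energy
    (h : RescaledSplitHypotheses γ ε₀ K ε C₁ C₂ C₃ n₀ N η β τ Y W F) (k : ℤ) {t : ℝ}
    (ht : τ (n₀ - N) ≤ t) : |Y 3 k t ^ 2 - W 2 k t ^ 2| ≤ 2 * F k t := by
  have h2 := h.sq_add_sqW_le_two_mul_energy 3 2 k ht
  rw [abs_le]
  constructor <;> nlinarith [sq_nonneg (Y 3 k t), sq_nonneg (W 2 k t)]

/-- Continuity of the symmetric amplitudes on compact intervals past `τ_{n₀-N}`.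
[cite: Tao2016AveragedNS, §6.4 Prop. 6.5] -/
theorem RescaledSplitHypotheses.continuousOn_Y
    (h : RescaledSplitHypotheses γ ε₀ K ε C₁ C₂ C₃ n₀ N η β τ Y W F) (i : Fin 4) (k : ℤ) {a b : ℝ}
    (ha : τ (n₀ - N) ≤ a) : ContinuousOn (Y i k) (Icc a b) :=
  continuousOn_Icc_of_contDiffOn (h.contDiffOn_Y i k) ha

/-- Continuity of the asymmetries on compact intervals past `τ_{n₀-N}`.
[cite: Tao2016AveragedNS, §6.4 Prop. 6.5] -/
theorem RescaledSplitHypotheses.continuousOn_W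
    (h : RescaledSplitHypotheses γ ε₀ K ε C₁ C₂ C₃ n₀ N η β τ Y W F) (i : Fin 3) (k : ℤ) {a b : ℝ}
    (ha : τ (n₀ - N) ≤ a) : ContinuousOn (W i k) (Icc a b) :=
  continuousOn_Icc_of_contDiffOn (h.contDiffOn_W i k) ha

/-- Continuity of the energies on compact intervals past `τ_{n₀-N}`.
[cite: Tao2016AveragedNS, §6.4 Prop. 6.5] -/
theorem RescaledSplitHypotheses.continuousOn_F
    (h : RescaledSplitHypotheses γ ε₀ K ε C₁ C₂ C₃ n₀ N η β τ Y W F) (k : ℤ) {a b : ℝ}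
    (ha : τ (n₀ - N) ≤ a) : ContinuousOn (F k) (Icc a b) :=
  continuousOn_Icc_of_contDiffOn (h.contDiffOn_F k) ha

/-- One-sided derivatives of the symmetric amplitudes in the form consumed by the comparison
lemmas. [cite: Tao2016AveragedNS, §6.4 Prop. 6.5] -/
theorem RescaledSplitHypotheses.hasDeriv_Y
    (h : RescaledSplitHypotheses γ ε₀ K ε C₁ C₂ C₃ n₀ N η β τ Y W F) (i : Fin 4) (k : ℤ) {t : ℝ}
    (ht : τ (n₀ - N) ≤ t) :
    HasDerivWithinAt (Y i k) (derivWithin (Y i k) (Ici (τ (n₀ - N))) t) (Ici t) t :=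
  hasDerivWithinAt_Ici_of_contDiffOn (h.contDiffOn_Y i k) ht

/-- One-sided derivatives of the asymmetries. [cite: Tao2016AveragedNS, §6.4 Prop. 6.5] -/
theorem RescaledSplitHypotheses.hasDeriv_W
    (h : RescaledSplitHypotheses γ ε₀ K ε C₁ C₂ C₃ n₀ N η β τ Y W F) (i : Fin 3) (k : ℤ) {t : ℝ}
    (ht : τ (n₀ - N) ≤ t) :
    HasDerivWithinAt (W i k) (derivWithin (W i k) (Ici (τ (n₀ - N))) t) (Ici t) t :=
  hasDerivWithinAt_Ici_of_contDiffOn (h.contDiffOn_W i k) ht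

/-- One-sided derivatives of the energies. [cite: Tao2016AveragedNS, §6.4 Prop. 6.5] -/
theorem RescaledSplitHypotheses.hasDeriv_F
    (h : RescaledSplitHypotheses γ ε₀ K ε C₁ C₂ C₃ n₀ N η β τ Y W F) (k : ℤ) {t : ℝ}
    (ht : τ (n₀ - N) ≤ t) :
    HasDerivWithinAt (F k) (derivWithin (F k) (Ici (τ (n₀ - N))) t) (Ici t) t :=
  hasDerivWithinAt_Ici_of_contDiffOn (h.contDiffOn_F k) ht

end Basic

section FiveModes

variable {γ ε₀ K ε C₁ C₂ C₃ : ℝ} {n₀ N : ℤ} {η : ℤ → ℝ} {β : ℕ → ℝ} {τ : ℤ → ℝ}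
  {Y : Fin 4 → ℤ → ℝ → ℝ} {W : Fin 3 → ℤ → ℝ → ℝ} {F : ℤ → ℝ → ℝ}

/-! ## (6.129♯)–(6.133♯): the five-mode equations at scale `0` (and `ã₁`) with explicit errors -/

/-- `|x y| ≤ ζ²` when `|x|, |y| ≤ ζ`. [folklore] -/
private theorem abs_mul_le_sq {x y ζ : ℝ} (hx : |x| ≤ ζ) (hy : |y| ≤ ζ) : |x * y| ≤ ζ ^ 2 := by
  rw [abs_mul, sq]
  exact mul_le_mul hx hy (abs_nonneg _) ((abs_nonneg _).trans hx)

/-- `x² ≤ ζ²` when `|x| ≤ ζ`. [folklore] -/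
private theorem sq_le_sq_of_abs_le {x ζ : ℝ} (hx : |x| ≤ ζ) : x ^ 2 ≤ ζ ^ 2 := by
  rw [← sq_abs x]; exact pow_le_pow_left₀ (abs_nonneg _) hx 2

/-- The error weight at scale `0` is at most `C₁(1+ε₀)^{-n₀/2}` when `Ẽ₀ ≤ 1`.
[cite: Tao2016AveragedNS, §6.4 (6.45)] -/
theorem RescaledSplitHypotheses.err_zero_le
    (h : RescaledSplitHypotheses γ ε₀ K ε C₁ C₂ C₃ n₀ N η β τ Y W F) (hC₁ : 0 ≤ C₁)
    (hε₀ : -1 < ε₀) {t : ℝ} (hE0 : F 0 t ≤ 1) :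
    C₁ * (1 + ε₀) ^ (-((n₀ : ℝ) / 2)) * Real.sqrt (F 0 t) ≤ C₁ * (1 + ε₀) ^ (-((n₀ : ℝ) / 2)) := by
  have _ := h.tau_zero
  have hsq : Real.sqrt (F 0 t) ≤ 1 := by
    rw [Real.sqrt_le_left zero_le_one]; simpa using hE0
  have hw : 0 ≤ C₁ * (1 + ε₀) ^ (-((n₀ : ℝ) / 2)) :=
    mul_nonneg hC₁ (Real.rpow_nonneg (by linarith) _)
  calc C₁ * (1 + ε₀) ^ (-((n₀ : ℝ) / 2)) * Real.sqrt (F 0 t)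
      ≤ C₁ * (1 + ε₀) ^ (-((n₀ : ℝ) / 2)) * 1 := mul_le_mul_of_nonneg_left hsq hw
    _ = _ := mul_one _

/-- **(6.129♯) with explicit error.** At a time `t ≥ τ_{n₀-N}` with `Ẽ₀(t) ≤ 1`, `Ẽ₋₁(t) ≤ Em`
and `|Z̃_{c,0}(t)|, |Z̃_{d,0}(t)| ≤ ζ`:
`|∂ₜã₀ + ε⁻²c̃₀d̃₀| ≤ 2ε + 2ε²e^{-K^{10}} + 2K Em + C₁(1+ε₀)^{-n₀/2} + ε⁻²ζ²`. The two-way hand-off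
`K(d̃²_{-1} - Z̃²_{d,-1})` is bounded by `2K Em` exactly as Tao's `K d²_{-1}`; the rotor correction
`ε⁻²Z̃_cZ̃_d` is the one extra term. [cite: Tao2016AveragedNS, §6.6 (6.129)] -/
theorem RescaledSplitHypotheses.eq_a_zero
    (h : RescaledSplitHypotheses γ ε₀ K ε C₁ C₂ C₃ n₀ N η β τ Y W F) (hε : 0 ≤ ε) (hK : 0 ≤ K)
    (hC₁ : 0 ≤ C₁) (hε₀ : -1 < ε₀) {t Em ζ : ℝ} (ht : τ (n₀ - N) ≤ t) (hE0 : F 0 t ≤ 1)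
    (hEm : F (-1) t ≤ Em) (hWc : |W 1 0 t| ≤ ζ) (hWd : |W 2 0 t| ≤ ζ) :
    |derivWithin (Y 0 0) (Ici (τ (n₀ - N))) t + (ε ^ 2)⁻¹ * Y 2 0 t * Y 3 0 t| ≤
      2 * ε + 2 * ε ^ 2 * Real.exp (-K ^ 10) + 2 * K * Em + C₁ * (1 + ε₀) ^ (-((n₀ : ℝ) / 2)) +
        (ε ^ 2)⁻¹ * ζ ^ 2 := by
  have h1 := h.eq1 0 t ht
  simp only [Int.cast_zero, mul_zero, zero_div, Real.rpow_zero, one_mul, zero_sub] at h1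
  have hab := h.abs_mul_le_two_mul_energy 0 1 0 ht
  have hac := h.abs_mul_le_two_mul_energy 0 2 0 ht
  have hdd := h.abs_sq_sub_sqW_le_two_mul_energy (-1) ht
  have hcd := abs_mul_le_sq hWc hWd
  have t0 := h1.trans (h.err_zero_le hC₁ hε₀ hE0)
  have key : derivWithin (Y 0 0) (Ici (τ (n₀ - N))) t + (ε ^ 2)⁻¹ * Y 2 0 t * Y 3 0 t =
      (derivWithin (Y 0 0) (Ici (τ (n₀ - N))) t -
        (-(ε ^ 2)⁻¹ * Y 2 0 t * Y 3 0 t - ε * Y 0 0 t * Y 1 0 t -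
          ε ^ 2 * Real.exp (-K ^ 10) * Y 0 0 t * Y 2 0 t + K * Y 3 (-1) t ^ 2 +
          (ε ^ 2)⁻¹ * W 1 0 t * W 2 0 t - K * W 2 (-1) t ^ 2)) +
      (-(ε * (Y 0 0 t * Y 1 0 t)) - ε ^ 2 * Real.exp (-K ^ 10) * (Y 0 0 t * Y 2 0 t) +
        K * (Y 3 (-1) t ^ 2 - W 2 (-1) t ^ 2) + (ε ^ 2)⁻¹ * (W 1 0 t * W 2 0 t)) := by ring
  rw [key]
  refine (abs_add_le _ _).trans ?_
  have t1 : |-(ε * (Y 0 0 t * Y 1 0 t))| ≤ 2 * ε := by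
    rw [abs_neg, abs_mul, abs_of_nonneg hε]; nlinarith
  have t2 : |ε ^ 2 * Real.exp (-K ^ 10) * (Y 0 0 t * Y 2 0 t)| ≤ 2 * ε ^ 2 * Real.exp (-K ^ 10) := by
    rw [abs_mul, abs_of_nonneg (by positivity)]
    have : 0 ≤ ε ^ 2 * Real.exp (-K ^ 10) := by positivity
    nlinarith
  have t3 : |K * (Y 3 (-1) t ^ 2 - W 2 (-1) t ^ 2)| ≤ 2 * K * Em := by
    rw [abs_mul, abs_of_nonneg hK]; nlinarith
  have t4 : |(ε ^ 2)⁻¹ * (W 1 0 t * W 2 0 t)| ≤ (ε ^ 2)⁻¹ * ζ ^ 2 := by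
    rw [abs_mul, abs_of_nonneg (by positivity)]
    exact mul_le_mul_of_nonneg_left hcd (by positivity)
  have hs1 := abs_add_le (-(ε * (Y 0 0 t * Y 1 0 t)) - ε ^ 2 * Real.exp (-K ^ 10) * (Y 0 0 t * Y 2 0 t) +
    K * (Y 3 (-1) t ^ 2 - W 2 (-1) t ^ 2)) ((ε ^ 2)⁻¹ * (W 1 0 t * W 2 0 t))
  have hs2 := abs_add_le (-(ε * (Y 0 0 t * Y 1 0 t)) - ε ^ 2 * Real.exp (-K ^ 10) * (Y 0 0 t * Y 2 0 t))
    (K * (Y 3 (-1) t ^ 2 - W 2 (-1) t ^ 2))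
  have hs3 := abs_sub (-(ε * (Y 0 0 t * Y 1 0 t))) (ε ^ 2 * Real.exp (-K ^ 10) * (Y 0 0 t * Y 2 0 t))
  linarith

/-- **(6.130♯) with explicit error**: `|∂ₜb̃₀ - (εã₀² - ε⁻¹K^{10}c̃₀²)| ≤ C₁(1+ε₀)^{-n₀/2} +
(ε + ε⁻¹K¹⁰)ζ²` when `Ẽ₀(t) ≤ 1` and `|Z̃_{a,0}(t)|, |Z̃_{c,0}(t)| ≤ ζ` (extra terms
`-εZ̃_a² + ε⁻¹K¹⁰Z̃_c²`). [cite: Tao2016AveragedNS, §6.6 (6.130)] -/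
theorem RescaledSplitHypotheses.eq_b_zero
    (h : RescaledSplitHypotheses γ ε₀ K ε C₁ C₂ C₃ n₀ N η β τ Y W F) (hε : 0 ≤ ε)
    (hC₁ : 0 ≤ C₁) (hε₀ : -1 < ε₀) {t ζ : ℝ} (ht : τ (n₀ - N) ≤ t) (hE0 : F 0 t ≤ 1)
    (hWa : |W 0 0 t| ≤ ζ) (hWc : |W 1 0 t| ≤ ζ) :
    |derivWithin (Y 1 0) (Ici (τ (n₀ - N))) t - (ε * Y 0 0 t ^ 2 - ε⁻¹ * K ^ 10 * Y 2 0 t ^ 2)| ≤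
      C₁ * (1 + ε₀) ^ (-((n₀ : ℝ) / 2)) + (ε + ε⁻¹ * K ^ 10) * ζ ^ 2 := by
  have h2 := h.eq2 0 t ht
  simp only [Int.cast_zero, mul_zero, zero_div, Real.rpow_zero, one_mul, zero_sub] at h2
  have t0 := h2.trans (h.err_zero_le hC₁ hε₀ hE0)
  have ha := sq_le_sq_of_abs_le hWa
  have hc := sq_le_sq_of_abs_le hWc
  have key : derivWithin (Y 1 0) (Ici (τ (n₀ - N))) t - (ε * Y 0 0 t ^ 2 - ε⁻¹ * K ^ 10 * Y 2 0 t ^ 2) =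
      (derivWithin (Y 1 0) (Ici (τ (n₀ - N))) t -
        (ε * Y 0 0 t ^ 2 - ε⁻¹ * K ^ 10 * Y 2 0 t ^ 2 - ε * W 0 0 t ^ 2 +
          ε⁻¹ * K ^ 10 * W 1 0 t ^ 2)) +
      (-(ε * W 0 0 t ^ 2) + ε⁻¹ * K ^ 10 * W 1 0 t ^ 2) := by ring
  rw [key]
  refine (abs_add_le _ _).trans ?_
  have hK10 : 0 ≤ ε⁻¹ * K ^ 10 := by positivity
  have t1 : |-(ε * W 0 0 t ^ 2) + ε⁻¹ * K ^ 10 * W 1 0 t ^ 2| ≤ (ε + ε⁻¹ * K ^ 10) * ζ ^ 2 := by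
    refine (abs_add_le _ _).trans ?_
    rw [abs_neg, abs_of_nonneg (by positivity), abs_of_nonneg (by positivity)]
    nlinarith [mul_le_mul_of_nonneg_left ha hε, mul_le_mul_of_nonneg_left hc hK10]
  linarith

/-- **(6.131♯) with explicit error**: `|∂ₜc̃₀ - (ε²e^{-K^{10}}ã₀² + ε⁻¹K^{10}b̃₀c̃₀)| ≤
C₁(1+ε₀)^{-n₀/2} + ε²e^{-K¹⁰}ζ²` when `Ẽ₀(t) ≤ 1` and `|Z̃_{a,0}(t)| ≤ ζ` (extra term
`-ε²e^{-K¹⁰}Z̃_a²`). [cite: Tao2016AveragedNS, §6.6 (6.131)] -/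
theorem RescaledSplitHypotheses.eq_c_zero
    (h : RescaledSplitHypotheses γ ε₀ K ε C₁ C₂ C₃ n₀ N η β τ Y W F) (hC₁ : 0 ≤ C₁)
    (hε₀ : -1 < ε₀) {t ζ : ℝ} (ht : τ (n₀ - N) ≤ t) (hE0 : F 0 t ≤ 1) (hWa : |W 0 0 t| ≤ ζ) :
    |derivWithin (Y 2 0) (Ici (τ (n₀ - N))) t -
        (ε ^ 2 * Real.exp (-K ^ 10) * Y 0 0 t ^ 2 + ε⁻¹ * K ^ 10 * Y 1 0 t * Y 2 0 t)| ≤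
      C₁ * (1 + ε₀) ^ (-((n₀ : ℝ) / 2)) + ε ^ 2 * Real.exp (-K ^ 10) * ζ ^ 2 := by
  have h3 := h.eq3 0 t ht
  simp only [Int.cast_zero, mul_zero, zero_div, Real.rpow_zero, one_mul, zero_sub] at h3
  have t0 := h3.trans (h.err_zero_le hC₁ hε₀ hE0)
  have ha := sq_le_sq_of_abs_le hWa
  have key : derivWithin (Y 2 0) (Ici (τ (n₀ - N))) t -
      (ε ^ 2 * Real.exp (-K ^ 10) * Y 0 0 t ^ 2 + ε⁻¹ * K ^ 10 * Y 1 0 t * Y 2 0 t) =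
      (derivWithin (Y 2 0) (Ici (τ (n₀ - N))) t -
        (ε ^ 2 * Real.exp (-K ^ 10) * Y 0 0 t ^ 2 + ε⁻¹ * K ^ 10 * Y 1 0 t * Y 2 0 t -
          ε ^ 2 * Real.exp (-K ^ 10) * W 0 0 t ^ 2)) +
      -(ε ^ 2 * Real.exp (-K ^ 10) * W 0 0 t ^ 2) := by ring
  rw [key]
  refine (abs_add_le _ _).trans ?_
  have hl : 0 ≤ ε ^ 2 * Real.exp (-K ^ 10) := by positivity
  have t1 : |-(ε ^ 2 * Real.exp (-K ^ 10) * W 0 0 t ^ 2)| ≤ ε ^ 2 * Real.exp (-K ^ 10) * ζ ^ 2 := by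
    rw [abs_neg, abs_of_nonneg (by positivity)]
    exact mul_le_mul_of_nonneg_left ha hl
  linarith

/-- **(6.132♯) with explicit error**: `|∂ₜd̃₀ - (ε⁻²c̃₀ã₀ - (1+ε₀)^{5/2}Kd̃₀ã₁)| ≤
C₁(1+ε₀)^{-n₀/2} + ε⁻²ζ²` when `Ẽ₀(t) ≤ 1` and `|Z̃_{a,0}(t)|, |Z̃_{c,0}(t)| ≤ ζ` (extra term
`-ε⁻²Z̃_aZ̃_c`). [cite: Tao2016AveragedNS, §6.6 (6.132)] -/
theorem RescaledSplitHypotheses.eq_d_zero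
    (h : RescaledSplitHypotheses γ ε₀ K ε C₁ C₂ C₃ n₀ N η β τ Y W F) (hC₁ : 0 ≤ C₁)
    (hε₀ : -1 < ε₀) {t ζ : ℝ} (ht : τ (n₀ - N) ≤ t) (hE0 : F 0 t ≤ 1) (hWa : |W 0 0 t| ≤ ζ)
    (hWc : |W 1 0 t| ≤ ζ) :
    |derivWithin (Y 3 0) (Ici (τ (n₀ - N))) t -
        ((ε ^ 2)⁻¹ * Y 2 0 t * Y 0 0 t - (1 + ε₀) ^ ((5 : ℝ) / 2) * K * Y 3 0 t * Y 0 1 t)| ≤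
      C₁ * (1 + ε₀) ^ (-((n₀ : ℝ) / 2)) + (ε ^ 2)⁻¹ * ζ ^ 2 := by
  have h4 := h.eq4 0 t ht
  simp only [Int.cast_zero, mul_zero, zero_div, Real.rpow_zero, one_mul, zero_sub, zero_add] at h4
  have t0 := h4.trans (h.err_zero_le hC₁ hε₀ hE0)
  have hac := abs_mul_le_sq hWa hWc
  have key : derivWithin (Y 3 0) (Ici (τ (n₀ - N))) t -
      ((ε ^ 2)⁻¹ * Y 2 0 t * Y 0 0 t - (1 + ε₀) ^ ((5 : ℝ) / 2) * K * Y 3 0 t * Y 0 1 t) =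
      (derivWithin (Y 3 0) (Ici (τ (n₀ - N))) t -
        ((ε ^ 2)⁻¹ * Y 2 0 t * Y 0 0 t - (1 + ε₀) ^ ((5 : ℝ) / 2) * K * Y 3 0 t * Y 0 1 t -
          (ε ^ 2)⁻¹ * W 0 0 t * W 1 0 t)) +
      -((ε ^ 2)⁻¹ * (W 0 0 t * W 1 0 t)) := by ring
  rw [key]
  refine (abs_add_le _ _).trans ?_
  have t1 : |-((ε ^ 2)⁻¹ * (W 0 0 t * W 1 0 t))| ≤ (ε ^ 2)⁻¹ * ζ ^ 2 := by
    rw [abs_neg, abs_mul, abs_of_nonneg (by positivity)]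
    exact mul_le_mul_of_nonneg_left hac (by positivity)
  linarith

/-- **(6.133♯) with explicit error.** At a time `t ≥ τ_{n₀-N}` with `Ẽ₁(t) ≤ 1`, bounds
`|b̃₁(t)| ≤ B_b`, `|c̃₁(t)| ≤ B_c`, `|d̃₁(t)| ≤ B_d` on the scale-`1` secondary modes, and asymmetry
bounds `|Z̃_{c,1}(t)|, |Z̃_{d,1}(t)| ≤ ζ₁`, `|Z̃_{d,0}(t)| ≤ ζ₀` (`ε > 0`, `K ≥ 0`):
`|∂ₜã₁ - (1+ε₀)^{5/2}K d̃₀²| ≤ (1+ε₀)^{5/2}(εB_b + ε²e^{-K^{10}}B_c)·|ã₁| + (1+ε₀)^{5/2}ε⁻²B_cB_d +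
C₁(1+ε₀)^{2-n₀/2} + (1+ε₀)^{5/2}(ε⁻²ζ₁² + Kζ₀²)`. The last summand is THE hand-off correction
`-(1+ε₀)^{5/2}K Z̃²_{d,0}` (the pump of `ã₁` reads `d̃₀² - Z̃²_{d,0}`) plus the scale-`1` rotor
correction. [cite: Tao2016AveragedNS, §6.6 (6.133)] -/
theorem RescaledSplitHypotheses.eq_a_one
    (h : RescaledSplitHypotheses γ ε₀ K ε C₁ C₂ C₃ n₀ N η β τ Y W F) (hε : 0 < ε) (hK : 0 ≤ K)
    (hC₁ : 0 ≤ C₁) (hε₀ : -1 < ε₀) {t Bb Bc Bd ζ₀ ζ₁ : ℝ} (ht : τ (n₀ - N) ≤ t) (hE1 : F 1 t ≤ 1)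
    (hb : |Y 1 1 t| ≤ Bb) (hc : |Y 2 1 t| ≤ Bc) (hd : |Y 3 1 t| ≤ Bd)
    (hWc : |W 1 1 t| ≤ ζ₁) (hWd : |W 2 1 t| ≤ ζ₁) (hWd0 : |W 2 0 t| ≤ ζ₀) :
    |derivWithin (Y 0 1) (Ici (τ (n₀ - N))) t - (1 + ε₀) ^ ((5 : ℝ) / 2) * K * Y 3 0 t ^ 2| ≤
      (1 + ε₀) ^ ((5 : ℝ) / 2) * (ε * Bb + ε ^ 2 * Real.exp (-K ^ 10) * Bc) * |Y 0 1 t| +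
        ((1 + ε₀) ^ ((5 : ℝ) / 2) * (ε ^ 2)⁻¹ * Bc * Bd + C₁ * (1 + ε₀) ^ (2 - (n₀ : ℝ) / 2)) +
        (1 + ε₀) ^ ((5 : ℝ) / 2) * ((ε ^ 2)⁻¹ * ζ₁ ^ 2 + K * ζ₀ ^ 2) := by
  have h5 := h.eq1 1 t ht
  simp only [Int.cast_one, mul_one, sub_self] at h5
  have hq0 : (0 : ℝ) < 1 + ε₀ := by linarith
  have hq : 0 < (1 + ε₀) ^ ((5 : ℝ) / 2) := Real.rpow_pos_of_pos hq0 _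
  have hsq : Real.sqrt (F 1 t) ≤ 1 := by
    rw [Real.sqrt_le_left zero_le_one]; simpa using hE1
  have hw : 0 ≤ C₁ * (1 + ε₀) ^ (2 - (n₀ : ℝ) / 2) := mul_nonneg hC₁ (Real.rpow_nonneg hq0.le _)
  have hBb : 0 ≤ Bb := (abs_nonneg _).trans hb
  have hBc : 0 ≤ Bc := (abs_nonneg _).trans hc
  have hBd : 0 ≤ Bd := (abs_nonneg _).trans hd
  have hcd1 := abs_mul_le_sq hWc hWd
  have hd0 := sq_le_sq_of_abs_le hWd0
  set Q := (1 + ε₀) ^ ((5 : ℝ) / 2) with hQ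
  have key : derivWithin (Y 0 1) (Ici (τ (n₀ - N))) t - Q * K * Y 3 0 t ^ 2 =
      (derivWithin (Y 0 1) (Ici (τ (n₀ - N))) t -
        Q * (-(ε ^ 2)⁻¹ * Y 2 1 t * Y 3 1 t - ε * Y 0 1 t * Y 1 1 t -
          ε ^ 2 * Real.exp (-K ^ 10) * Y 0 1 t * Y 2 1 t + K * Y 3 0 t ^ 2 +
          (ε ^ 2)⁻¹ * W 1 1 t * W 2 1 t - K * W 2 0 t ^ 2)) +
      (Q * (-((ε ^ 2)⁻¹ * (Y 2 1 t * Y 3 1 t)) -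
        (ε * Y 1 1 t + ε ^ 2 * Real.exp (-K ^ 10) * Y 2 1 t) * Y 0 1 t) +
        Q * ((ε ^ 2)⁻¹ * (W 1 1 t * W 2 1 t) - K * W 2 0 t ^ 2)) := by ring
  rw [key]
  refine (abs_add_le _ _).trans ?_
  have t0 : |derivWithin (Y 0 1) (Ici (τ (n₀ - N))) t -
      Q * (-(ε ^ 2)⁻¹ * Y 2 1 t * Y 3 1 t - ε * Y 0 1 t * Y 1 1 t -
        ε ^ 2 * Real.exp (-K ^ 10) * Y 0 1 t * Y 2 1 t + K * Y 3 0 t ^ 2 +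
        (ε ^ 2)⁻¹ * W 1 1 t * W 2 1 t - K * W 2 0 t ^ 2)| ≤
      C₁ * (1 + ε₀) ^ (2 - (n₀ : ℝ) / 2) := by
    refine h5.trans ?_
    calc C₁ * (1 + ε₀) ^ (2 - (n₀ : ℝ) / 2) * Real.sqrt (F 1 t) ≤
        C₁ * (1 + ε₀) ^ (2 - (n₀ : ℝ) / 2) * 1 := mul_le_mul_of_nonneg_left hsq hw
      _ = _ := mul_one _
  have hcd : |Y 2 1 t * Y 3 1 t| ≤ Bc * Bd := by
    rw [abs_mul]; exact mul_le_mul hc hd (abs_nonneg _) hBc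
  have hlam : 0 ≤ ε ^ 2 * Real.exp (-K ^ 10) := by positivity
  have hrate : |ε * Y 1 1 t + ε ^ 2 * Real.exp (-K ^ 10) * Y 2 1 t| ≤
      ε * Bb + ε ^ 2 * Real.exp (-K ^ 10) * Bc := by
    refine (abs_add_le _ _).trans ?_
    have u1 : |ε * Y 1 1 t| ≤ ε * Bb := by
      rw [abs_mul, abs_of_pos hε]; exact mul_le_mul_of_nonneg_left hb hε.le
    have u2 : |ε ^ 2 * Real.exp (-K ^ 10) * Y 2 1 t| ≤ ε ^ 2 * Real.exp (-K ^ 10) * Bc := by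
      rw [abs_mul, abs_of_nonneg hlam]; exact mul_le_mul_of_nonneg_left hc hlam
    linarith
  have t1 : |Q * (-((ε ^ 2)⁻¹ * (Y 2 1 t * Y 3 1 t)) -
      (ε * Y 1 1 t + ε ^ 2 * Real.exp (-K ^ 10) * Y 2 1 t) * Y 0 1 t)| ≤
      Q * ((ε ^ 2)⁻¹ * (Bc * Bd) + (ε * Bb + ε ^ 2 * Real.exp (-K ^ 10) * Bc) * |Y 0 1 t|) := by
    rw [abs_mul, abs_of_pos hq]
    apply mul_le_mul_of_nonneg_left _ hq.le
    refine (abs_sub _ _).trans ?_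
    rw [abs_neg, abs_mul, abs_of_pos (by positivity : (0 : ℝ) < (ε ^ 2)⁻¹),
      abs_mul (ε * Y 1 1 t + ε ^ 2 * Real.exp (-K ^ 10) * Y 2 1 t)]
    exact add_le_add (mul_le_mul_of_nonneg_left hcd (by positivity))
      (mul_le_mul_of_nonneg_right hrate (abs_nonneg _))
  have t2 : |Q * ((ε ^ 2)⁻¹ * (W 1 1 t * W 2 1 t) - K * W 2 0 t ^ 2)| ≤
      Q * ((ε ^ 2)⁻¹ * ζ₁ ^ 2 + K * ζ₀ ^ 2) := by
    rw [abs_mul, abs_of_pos hq]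
    apply mul_le_mul_of_nonneg_left _ hq.le
    refine (abs_sub _ _).trans ?_
    have u1 : |(ε ^ 2)⁻¹ * (W 1 1 t * W 2 1 t)| ≤ (ε ^ 2)⁻¹ * ζ₁ ^ 2 := by
      rw [abs_mul, abs_of_pos (by positivity : (0 : ℝ) < (ε ^ 2)⁻¹)]
      exact mul_le_mul_of_nonneg_left hcd1 (by positivity)
    have u2 : |K * W 2 0 t ^ 2| ≤ K * ζ₀ ^ 2 := by
      rw [abs_mul, abs_of_nonneg hK, abs_of_nonneg (sq_nonneg _)]
      exact mul_le_mul_of_nonneg_left hd0 hK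
    exact add_le_add u1 u2
  have e1 : Q * ((ε ^ 2)⁻¹ * (Bc * Bd) + (ε * Bb + ε ^ 2 * Real.exp (-K ^ 10) * Bc) * |Y 0 1 t|) =
      Q * (ε * Bb + ε ^ 2 * Real.exp (-K ^ 10) * Bc) * |Y 0 1 t| + Q * (ε ^ 2)⁻¹ * Bc * Bd := by
    ring
  have hs := abs_add_le (Q * (-((ε ^ 2)⁻¹ * (Y 2 1 t * Y 3 1 t)) -
      (ε * Y 1 1 t + ε ^ 2 * Real.exp (-K ^ 10) * Y 2 1 t) * Y 0 1 t))
    (Q * ((ε ^ 2)⁻¹ * (W 1 1 t * W 2 1 t) - K * W 2 0 t ^ 2))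
  linarith

/-- **The energy inequality (6.49♯) at scale `0` with the input term bounded**: when
`Ẽ₋₁(t) ≤ Em`, `Ẽ₀(t) ≤ 1` and `|Z̃_{d,0}(t)| ≤ ζ` (`K ≥ 0`, `ε₀ > -1`),
`∂ₜẼ₀ ≤ -(1+ε₀)^{5/2}K d̃₀² ã₁ + 2√2 K Em + (1+ε₀)^{5/2}K ζ²|ã₁|` — the inflow
`K(d̃²_{-1} - Z̃²_{d,-1})ã₀` is bounded by `2√2 K Em` exactly as Tao's, and the outflow carries the
correction `+(1+ε₀)^{5/2}K Z̃²_{d,0} ã₁`. [cite: Tao2016AveragedNS, §6.4 (6.49)] -/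
theorem RescaledSplitHypotheses.energy_zero_deriv_le
    (h : RescaledSplitHypotheses γ ε₀ K ε C₁ C₂ C₃ n₀ N η β τ Y W F) (hK : 0 ≤ K) (hε₀ : -1 < ε₀)
    {t Em ζ : ℝ} (ht : τ (n₀ - N) ≤ t) (hE0 : F 0 t ≤ 1) (hEm : F (-1) t ≤ Em)
    (hWd : |W 2 0 t| ≤ ζ) :
    derivWithin (F 0) (Ici (τ (n₀ - N))) t ≤
      -((1 + ε₀) ^ ((5 : ℝ) / 2) * K * Y 3 0 t ^ 2 * Y 0 1 t) + 2 * Real.sqrt 2 * K * Em +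
        (1 + ε₀) ^ ((5 : ℝ) / 2) * K * ζ ^ 2 * |Y 0 1 t| := by
  have hen := h.energy 0 t ht
  simp only [Int.cast_zero, mul_zero, zero_div, Real.rpow_zero, mul_one, zero_sub, zero_add] at hen
  have hq : 0 < (1 + ε₀) ^ ((5 : ℝ) / 2) := Real.rpow_pos_of_pos (by linarith) _
  have hdd := h.abs_sq_sub_sqW_le_two_mul_energy (-1) ht
  have hd0 := sq_le_sq_of_abs_le hWd
  have ha : |Y 0 0 t| ≤ Real.sqrt 2 := by
    refine (h.abs_le_sqrt_energy 0 0 ht).trans (Real.sqrt_le_sqrt (by linarith))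
  have hEm0 : 0 ≤ Em := by
    have := (abs_nonneg _).trans hdd
    linarith
  have t1 : K * ((Y 3 (-1) t ^ 2 - W 2 (-1) t ^ 2) * Y 0 0 t) ≤ 2 * Real.sqrt 2 * K * Em := by
    have h1 : (Y 3 (-1) t ^ 2 - W 2 (-1) t ^ 2) * Y 0 0 t ≤
        |Y 3 (-1) t ^ 2 - W 2 (-1) t ^ 2| * |Y 0 0 t| := by
      rw [← abs_mul]; exact le_abs_self _
    have h2 : |Y 3 (-1) t ^ 2 - W 2 (-1) t ^ 2| * |Y 0 0 t| ≤ (2 * Em) * Real.sqrt 2 :=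
      mul_le_mul (hdd.trans (by linarith)) ha (abs_nonneg _) (by positivity)
    nlinarith
  have t2 : (1 + ε₀) ^ ((5 : ℝ) / 2) * K * W 2 0 t ^ 2 * Y 0 1 t ≤
      (1 + ε₀) ^ ((5 : ℝ) / 2) * K * ζ ^ 2 * |Y 0 1 t| := by
    calc (1 + ε₀) ^ ((5 : ℝ) / 2) * K * W 2 0 t ^ 2 * Y 0 1 t
        ≤ (1 + ε₀) ^ ((5 : ℝ) / 2) * K * W 2 0 t ^ 2 * |Y 0 1 t| :=
          mul_le_mul_of_nonneg_left (le_abs_self _) (by positivity)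
      _ ≤ (1 + ε₀) ^ ((5 : ℝ) / 2) * K * ζ ^ 2 * |Y 0 1 t| := by
          apply mul_le_mul_of_nonneg_right _ (abs_nonneg _)
          exact mul_le_mul_of_nonneg_left hd0 (by positivity)
  calc derivWithin (F 0) (Ici (τ (n₀ - N))) t
      ≤ K * ((Y 3 (-1) t ^ 2 - W 2 (-1) t ^ 2) * Y 0 0 t -
          (1 + ε₀) ^ ((5 : ℝ) / 2) * (Y 3 0 t ^ 2 - W 2 0 t ^ 2) * Y 0 1 t) := hen
    _ = K * ((Y 3 (-1) t ^ 2 - W 2 (-1) t ^ 2) * Y 0 0 t) -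
          (1 + ε₀) ^ ((5 : ℝ) / 2) * K * Y 3 0 t ^ 2 * Y 0 1 t +
          (1 + ε₀) ^ ((5 : ℝ) / 2) * K * W 2 0 t ^ 2 * Y 0 1 t := by ring
    _ ≤ _ := by linarith

end FiveModes

section FineModes

variable {γ ε₀ K ε C₁ C₂ C₃ : ℝ} {n₀ N : ℤ} {η : ℤ → ℝ} {β : ℕ → ℝ} {τ : ℤ → ℝ}
  {Y : Fin 4 → ℤ → ℝ → ℝ} {W : Fin 3 → ℤ → ℝ → ℝ} {F : ℤ → ℝ → ℝ}

/-! ## Scale `1`: the secondary modes `b̃₁, c̃₁, d̃₁` (inputs of the split Prop. 6.13)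

At scale `1` the tree integrates the equations over the whole rescaled past, where only energy
bounds are available; accordingly the asymmetry terms are kept EXACT here (they are bounded by
`2Ẽ₁` like the main terms, `sqW_le_two_mul_energy`), except in `d_one_linear` (used inside the
bootstrap window only), where a pointwise bound `ζ` is taken. -/

/-- **(6.46♯) at scale `1`**: `|∂ₜb̃₁ - (1+ε₀)^{5/2}(εã₁² - ε⁻¹K^{10}c̃₁² - εZ̃_{a,1}² + ε⁻¹K¹⁰Z̃_{c,1}²)| ≤
C₁(1+ε₀)^{2-n₀/2}√Ẽ₁`. [cite: Tao2016AveragedNS, §6.4 (6.46)] -/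
theorem RescaledSplitHypotheses.eq_b_one
    (h : RescaledSplitHypotheses γ ε₀ K ε C₁ C₂ C₃ n₀ N η β τ Y W F) {t : ℝ} (ht : τ (n₀ - N) ≤ t) :
    |derivWithin (Y 1 1) (Ici (τ (n₀ - N))) t -
        (1 + ε₀) ^ ((5 : ℝ) / 2) * (ε * Y 0 1 t ^ 2 - ε⁻¹ * K ^ 10 * Y 2 1 t ^ 2 -
          ε * W 0 1 t ^ 2 + ε⁻¹ * K ^ 10 * W 1 1 t ^ 2)| ≤
      C₁ * (1 + ε₀) ^ (2 - (n₀ : ℝ) / 2) * Real.sqrt (F 1 t) := by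
  have h2 := h.eq2 1 t ht
  simpa only [Int.cast_one, mul_one] using h2

/-- **(6.47♯) at scale `1`**: `|∂ₜc̃₁ - (1+ε₀)^{5/2}(ε²e^{-K^{10}}ã₁² + ε⁻¹K^{10}b̃₁c̃₁ - ε²e^{-K¹⁰}Z̃_{a,1}²)| ≤
C₁(1+ε₀)^{2-n₀/2}√Ẽ₁`. [cite: Tao2016AveragedNS, §6.4 (6.47)] -/
theorem RescaledSplitHypotheses.eq_c_one
    (h : RescaledSplitHypotheses γ ε₀ K ε C₁ C₂ C₃ n₀ N η β τ Y W F) {t : ℝ} (ht : τ (n₀ - N) ≤ t) :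
    |derivWithin (Y 2 1) (Ici (τ (n₀ - N))) t -
        (1 + ε₀) ^ ((5 : ℝ) / 2) *
          (ε ^ 2 * Real.exp (-K ^ 10) * Y 0 1 t ^ 2 + ε⁻¹ * K ^ 10 * Y 1 1 t * Y 2 1 t -
            ε ^ 2 * Real.exp (-K ^ 10) * W 0 1 t ^ 2)| ≤
      C₁ * (1 + ε₀) ^ (2 - (n₀ : ℝ) / 2) * Real.sqrt (F 1 t) := by
  have h3 := h.eq3 1 t ht
  simpa only [Int.cast_one, mul_one] using h3

/-- **(6.48♯) at scale `1`**: `|∂ₜd̃₁ - (1+ε₀)^{5/2}(ε⁻²c̃₁ã₁ - (1+ε₀)^{5/2}Kd̃₁ã₂ - ε⁻²Z̃_{a,1}Z̃_{c,1})| ≤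
C₁(1+ε₀)^{2-n₀/2}√Ẽ₁`. [cite: Tao2016AveragedNS, §6.4 (6.48)] -/
theorem RescaledSplitHypotheses.eq_d_one
    (h : RescaledSplitHypotheses γ ε₀ K ε C₁ C₂ C₃ n₀ N η β τ Y W F) {t : ℝ} (ht : τ (n₀ - N) ≤ t) :
    |derivWithin (Y 3 1) (Ici (τ (n₀ - N))) t -
        (1 + ε₀) ^ ((5 : ℝ) / 2) *
          ((ε ^ 2)⁻¹ * Y 2 1 t * Y 0 1 t - (1 + ε₀) ^ ((5 : ℝ) / 2) * K * Y 3 1 t * Y 0 2 t -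
            (ε ^ 2)⁻¹ * W 0 1 t * W 1 1 t)| ≤
      C₁ * (1 + ε₀) ^ (2 - (n₀ : ℝ) / 2) * Real.sqrt (F 1 t) := by
  have h4 := h.eq4 1 t ht
  simpa only [Int.cast_one, mul_one, Int.reduceAdd] using h4

/-- **The `c̃₁`-equation in linear form** (split Prop. 6.13): `|∂ₜc̃₁ - ((1+ε₀)^{5/2}ε⁻¹K^{10}b̃₁)·c̃₁| ≤
(1+ε₀)^{5/2}ε²e^{-K^{10}}(ã₁² + Z̃_{a,1}²) + C₁(1+ε₀)^{2-n₀/2}√Ẽ₁` — the shape of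
`abs_le_linearComparison` with rate `(1+ε₀)^{5/2}ε⁻¹K^{10}b̃₁`; the seed correction `-ε²e^{-K¹⁰}Z̃_a²`
joins the forcing (both are `≤ 2ε²e^{-K¹⁰}Ẽ₁`). [cite: Tao2016AveragedNS, §6.6 proof of Prop. 6.13] -/
theorem RescaledSplitHypotheses.c_one_linear
    (h : RescaledSplitHypotheses γ ε₀ K ε C₁ C₂ C₃ n₀ N η β τ Y W F) (hε₀ : -1 < ε₀) {t : ℝ}
    (ht : τ (n₀ - N) ≤ t) :
    |derivWithin (Y 2 1) (Ici (τ (n₀ - N))) t -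
        ((1 + ε₀) ^ ((5 : ℝ) / 2) * (ε⁻¹ * K ^ 10) * Y 1 1 t) * Y 2 1 t| ≤
      (1 + ε₀) ^ ((5 : ℝ) / 2) * (ε ^ 2 * Real.exp (-K ^ 10)) * (Y 0 1 t ^ 2 + W 0 1 t ^ 2) +
        C₁ * (1 + ε₀) ^ (2 - (n₀ : ℝ) / 2) * Real.sqrt (F 1 t) := by
  have he := h.eq_c_one ht
  have hQ : 0 < (1 + ε₀) ^ ((5 : ℝ) / 2) := Real.rpow_pos_of_pos (by linarith) _
  have key : derivWithin (Y 2 1) (Ici (τ (n₀ - N))) t -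
      ((1 + ε₀) ^ ((5 : ℝ) / 2) * (ε⁻¹ * K ^ 10) * Y 1 1 t) * Y 2 1 t =
      (derivWithin (Y 2 1) (Ici (τ (n₀ - N))) t -
        (1 + ε₀) ^ ((5 : ℝ) / 2) *
          (ε ^ 2 * Real.exp (-K ^ 10) * Y 0 1 t ^ 2 + ε⁻¹ * K ^ 10 * Y 1 1 t * Y 2 1 t -
            ε ^ 2 * Real.exp (-K ^ 10) * W 0 1 t ^ 2)) +
        (1 + ε₀) ^ ((5 : ℝ) / 2) * (ε ^ 2 * Real.exp (-K ^ 10)) * (Y 0 1 t ^ 2 - W 0 1 t ^ 2) := by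
    ring
  rw [key]
  refine (abs_add_le _ _).trans ?_
  have hl : 0 ≤ (1 + ε₀) ^ ((5 : ℝ) / 2) * (ε ^ 2 * Real.exp (-K ^ 10)) := by positivity
  have t1 : |(1 + ε₀) ^ ((5 : ℝ) / 2) * (ε ^ 2 * Real.exp (-K ^ 10)) * (Y 0 1 t ^ 2 - W 0 1 t ^ 2)| ≤
      (1 + ε₀) ^ ((5 : ℝ) / 2) * (ε ^ 2 * Real.exp (-K ^ 10)) * (Y 0 1 t ^ 2 + W 0 1 t ^ 2) := by
    rw [abs_mul, abs_of_nonneg hl]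
    apply mul_le_mul_of_nonneg_left _ hl
    rw [abs_le]
    constructor <;> nlinarith [sq_nonneg (Y 0 1 t), sq_nonneg (W 0 1 t)]
  linarith

/-- **The `b̃₁`-equation, bound on `|∂ₜb̃₁|`** (split Prop. 6.13): `|∂ₜb̃₁| ≤
(1+ε₀)^{5/2}(ε ã₁² + ε⁻¹K^{10} c̃₁² + εZ̃_{a,1}² + ε⁻¹K¹⁰Z̃_{c,1}²) + C₁(1+ε₀)^{2-n₀/2}√Ẽ₁` (`ε > 0`).
[cite: Tao2016AveragedNS, §6.6 proof of Prop. 6.13] -/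
theorem RescaledSplitHypotheses.b_one_deriv_abs_le
    (h : RescaledSplitHypotheses γ ε₀ K ε C₁ C₂ C₃ n₀ N η β τ Y W F) (hε : 0 < ε) (hε₀ : -1 < ε₀)
    {t : ℝ} (ht : τ (n₀ - N) ≤ t) :
    |derivWithin (Y 1 1) (Ici (τ (n₀ - N))) t| ≤
      (1 + ε₀) ^ ((5 : ℝ) / 2) * (ε * Y 0 1 t ^ 2 + ε⁻¹ * K ^ 10 * Y 2 1 t ^ 2 +
          ε * W 0 1 t ^ 2 + ε⁻¹ * K ^ 10 * W 1 1 t ^ 2) +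
        C₁ * (1 + ε₀) ^ (2 - (n₀ : ℝ) / 2) * Real.sqrt (F 1 t) := by
  have he := h.eq_b_one ht
  have hQ : 0 < (1 + ε₀) ^ ((5 : ℝ) / 2) := Real.rpow_pos_of_pos (by linarith) _
  have hmain : |(1 + ε₀) ^ ((5 : ℝ) / 2) * (ε * Y 0 1 t ^ 2 - ε⁻¹ * K ^ 10 * Y 2 1 t ^ 2 -
      ε * W 0 1 t ^ 2 + ε⁻¹ * K ^ 10 * W 1 1 t ^ 2)| ≤
      (1 + ε₀) ^ ((5 : ℝ) / 2) * (ε * Y 0 1 t ^ 2 + ε⁻¹ * K ^ 10 * Y 2 1 t ^ 2 +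
        ε * W 0 1 t ^ 2 + ε⁻¹ * K ^ 10 * W 1 1 t ^ 2) := by
    rw [abs_mul, abs_of_pos hQ]
    apply mul_le_mul_of_nonneg_left _ hQ.le
    have h1 : 0 ≤ ε * Y 0 1 t ^ 2 := by positivity
    have h2 : 0 ≤ ε⁻¹ * K ^ 10 * Y 2 1 t ^ 2 := by positivity
    have h3 : 0 ≤ ε * W 0 1 t ^ 2 := by positivity
    have h4 : 0 ≤ ε⁻¹ * K ^ 10 * W 1 1 t ^ 2 := by positivity
    rw [abs_le]; constructor <;> linarith
  have := abs_sub_abs_le_abs_sub (derivWithin (Y 1 1) (Ici (τ (n₀ - N))) t)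
    ((1 + ε₀) ^ ((5 : ℝ) / 2) * (ε * Y 0 1 t ^ 2 - ε⁻¹ * K ^ 10 * Y 2 1 t ^ 2 -
      ε * W 0 1 t ^ 2 + ε⁻¹ * K ^ 10 * W 1 1 t ^ 2))
  linarith

/-- **The `d̃₁`-equation in linear form** (split Prop. 6.13, last paragraph): with `|c̃₁| ≤ B_c`,
`Ẽ₁ ≤ 1`, and `|Z̃_{a,1}|, |Z̃_{c,1}| ≤ ζ`,
`|∂ₜd̃₁ - (-(1+ε₀)^{5}K ã₂)·d̃₁| ≤ (1+ε₀)^{5/2}ε⁻²B_c√2 + C₁(1+ε₀)^{2-n₀/2} + (1+ε₀)^{5/2}ε⁻²ζ²`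
(extra term: the rotor correction `-ε⁻²Z̃_aZ̃_c`).
[cite: Tao2016AveragedNS, §6.6 proof of Prop. 6.13] -/
theorem RescaledSplitHypotheses.d_one_linear
    (h : RescaledSplitHypotheses γ ε₀ K ε C₁ C₂ C₃ n₀ N η β τ Y W F) (hε₀ : -1 < ε₀) (hC₁ : 0 ≤ C₁)
    {t Bc ζ : ℝ} (ht : τ (n₀ - N) ≤ t) (hE1 : F 1 t ≤ 1) (hc : |Y 2 1 t| ≤ Bc)
    (hWa : |W 0 1 t| ≤ ζ) (hWc : |W 1 1 t| ≤ ζ) :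
    |derivWithin (Y 3 1) (Ici (τ (n₀ - N))) t -
        (-((1 + ε₀) ^ ((5 : ℝ) / 2) * (1 + ε₀) ^ ((5 : ℝ) / 2) * K * Y 0 2 t)) * Y 3 1 t| ≤
      (1 + ε₀) ^ ((5 : ℝ) / 2) * (ε ^ 2)⁻¹ * Bc * Real.sqrt 2 +
        C₁ * (1 + ε₀) ^ (2 - (n₀ : ℝ) / 2) + (1 + ε₀) ^ ((5 : ℝ) / 2) * (ε ^ 2)⁻¹ * ζ ^ 2 := by
  have he := h.eq_d_one ht
  have hq0 : (0 : ℝ) < 1 + ε₀ := by linarith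
  have hQ : 0 < (1 + ε₀) ^ ((5 : ℝ) / 2) := Real.rpow_pos_of_pos hq0 _
  have hBc : 0 ≤ Bc := (abs_nonneg _).trans hc
  have hac := abs_mul_le_sq hWa hWc
  have ha : |Y 0 1 t| ≤ Real.sqrt 2 :=
    (h.abs_le_sqrt_energy 0 1 ht).trans (Real.sqrt_le_sqrt (by linarith))
  have hsq : Real.sqrt (F 1 t) ≤ 1 := by
    rw [Real.sqrt_le_left zero_le_one]; simpa using hE1
  have hw : 0 ≤ C₁ * (1 + ε₀) ^ (2 - (n₀ : ℝ) / 2) := mul_nonneg hC₁ (Real.rpow_nonneg hq0.le _)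
  have key : derivWithin (Y 3 1) (Ici (τ (n₀ - N))) t -
      (-((1 + ε₀) ^ ((5 : ℝ) / 2) * (1 + ε₀) ^ ((5 : ℝ) / 2) * K * Y 0 2 t)) * Y 3 1 t =
      (derivWithin (Y 3 1) (Ici (τ (n₀ - N))) t -
        (1 + ε₀) ^ ((5 : ℝ) / 2) *
          ((ε ^ 2)⁻¹ * Y 2 1 t * Y 0 1 t - (1 + ε₀) ^ ((5 : ℝ) / 2) * K * Y 3 1 t * Y 0 2 t -
            (ε ^ 2)⁻¹ * W 0 1 t * W 1 1 t)) +
        ((1 + ε₀) ^ ((5 : ℝ) / 2) * (ε ^ 2)⁻¹ * (Y 2 1 t * Y 0 1 t) -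
          (1 + ε₀) ^ ((5 : ℝ) / 2) * (ε ^ 2)⁻¹ * (W 0 1 t * W 1 1 t)) := by ring
  rw [key]
  have t0 : |derivWithin (Y 3 1) (Ici (τ (n₀ - N))) t -
      (1 + ε₀) ^ ((5 : ℝ) / 2) *
        ((ε ^ 2)⁻¹ * Y 2 1 t * Y 0 1 t - (1 + ε₀) ^ ((5 : ℝ) / 2) * K * Y 3 1 t * Y 0 2 t -
          (ε ^ 2)⁻¹ * W 0 1 t * W 1 1 t)| ≤ C₁ * (1 + ε₀) ^ (2 - (n₀ : ℝ) / 2) := by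
    refine he.trans ?_
    calc C₁ * (1 + ε₀) ^ (2 - (n₀ : ℝ) / 2) * Real.sqrt (F 1 t)
        ≤ C₁ * (1 + ε₀) ^ (2 - (n₀ : ℝ) / 2) * 1 := mul_le_mul_of_nonneg_left hsq hw
      _ = _ := mul_one _
  have t1 : |(1 + ε₀) ^ ((5 : ℝ) / 2) * (ε ^ 2)⁻¹ * (Y 2 1 t * Y 0 1 t)| ≤
      (1 + ε₀) ^ ((5 : ℝ) / 2) * (ε ^ 2)⁻¹ * Bc * Real.sqrt 2 := by
    rw [abs_mul, abs_of_nonneg (by positivity : (0 : ℝ) ≤ (1 + ε₀) ^ ((5 : ℝ) / 2) * (ε ^ 2)⁻¹),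
      abs_mul]
    have : |Y 2 1 t| * |Y 0 1 t| ≤ Bc * Real.sqrt 2 := mul_le_mul hc ha (abs_nonneg _) hBc
    calc (1 + ε₀) ^ ((5 : ℝ) / 2) * (ε ^ 2)⁻¹ * (|Y 2 1 t| * |Y 0 1 t|)
        ≤ (1 + ε₀) ^ ((5 : ℝ) / 2) * (ε ^ 2)⁻¹ * (Bc * Real.sqrt 2) :=
          mul_le_mul_of_nonneg_left this (by positivity)
      _ = _ := by ring
  have t2 : |(1 + ε₀) ^ ((5 : ℝ) / 2) * (ε ^ 2)⁻¹ * (W 0 1 t * W 1 1 t)| ≤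
      (1 + ε₀) ^ ((5 : ℝ) / 2) * (ε ^ 2)⁻¹ * ζ ^ 2 := by
    rw [abs_mul, abs_of_nonneg (by positivity : (0 : ℝ) ≤ (1 + ε₀) ^ ((5 : ℝ) / 2) * (ε ^ 2)⁻¹)]
    exact mul_le_mul_of_nonneg_left hac (by positivity)
  have hs1 := abs_add_le (derivWithin (Y 3 1) (Ici (τ (n₀ - N))) t -
      (1 + ε₀) ^ ((5 : ℝ) / 2) *
        ((ε ^ 2)⁻¹ * Y 2 1 t * Y 0 1 t - (1 + ε₀) ^ ((5 : ℝ) / 2) * K * Y 3 1 t * Y 0 2 t -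
          (ε ^ 2)⁻¹ * W 0 1 t * W 1 1 t))
    ((1 + ε₀) ^ ((5 : ℝ) / 2) * (ε ^ 2)⁻¹ * (Y 2 1 t * Y 0 1 t) -
      (1 + ε₀) ^ ((5 : ℝ) / 2) * (ε ^ 2)⁻¹ * (W 0 1 t * W 1 1 t))
  have hs2 := abs_sub ((1 + ε₀) ^ ((5 : ℝ) / 2) * (ε ^ 2)⁻¹ * (Y 2 1 t * Y 0 1 t))
    ((1 + ε₀) ^ ((5 : ℝ) / 2) * (ε ^ 2)⁻¹ * (W 0 1 t * W 1 1 t))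
  linarith

/-- The rate of `d_one_linear` is small: `|(1+ε₀)^5 K ã₂| ≤ (1+ε₀)^5 K √(2Ẽ₂)` (`K ≥ 0`).
[cite: Tao2016AveragedNS, §6.6 proof of Prop. 6.13] -/
theorem RescaledSplitHypotheses.d_one_rate_abs_le
    (h : RescaledSplitHypotheses γ ε₀ K ε C₁ C₂ C₃ n₀ N η β τ Y W F) (hε₀ : -1 < ε₀) (hK : 0 ≤ K)
    {t : ℝ} (ht : τ (n₀ - N) ≤ t) :
    |-((1 + ε₀) ^ ((5 : ℝ) / 2) * (1 + ε₀) ^ ((5 : ℝ) / 2) * K * Y 0 2 t)| ≤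
      (1 + ε₀) ^ ((5 : ℝ) / 2) * (1 + ε₀) ^ ((5 : ℝ) / 2) * K * Real.sqrt (2 * F 2 t) := by
  have hQ : 0 < (1 + ε₀) ^ ((5 : ℝ) / 2) := Real.rpow_pos_of_pos (by linarith) _
  rw [abs_neg, abs_mul, abs_of_nonneg (by positivity)]
  exact mul_le_mul_of_nonneg_left (h.abs_le_sqrt_energy 0 2 ht) (by positivity)

end FineModes

section CoarseModes

variable {γ ε₀ K ε C₁ C₂ C₃ : ℝ} {n₀ N : ℤ} {η : ℤ → ℝ} {β : ℕ → ℝ} {τ : ℤ → ℝ}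
  {Y : Fin 4 → ℤ → ℝ → ℝ} {W : Fin 3 → ℤ → ℝ → ℝ} {F : ℤ → ℝ → ℝ}

/-! ## (6.134♯)–(6.137♯), (6.177♯): the coarse-scale modes `ã₋₁, b̃₋₁, c̃₋₁, d̃₋₁` -/

/-- The error weight of (6.45♯)–(6.48♯) at scale `-1`, `C₁(1+ε₀)^{-2-n₀/2}√Ẽ₋₁`, is at most
`C₁(1+ε₀)^{-2-n₀/2}√E₁` when `Ẽ₋₁ ≤ E₁`. [cite: Tao2016AveragedNS, §6.4 (6.45)] -/
theorem RescaledSplitHypotheses.err_neg_one_le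
    (h : RescaledSplitHypotheses γ ε₀ K ε C₁ C₂ C₃ n₀ N η β τ Y W F) (hC₁ : 0 ≤ C₁) (hε₀ : -1 < ε₀)
    {t E₁ : ℝ} (hEm : F (-1) t ≤ E₁) :
    C₁ * (1 + ε₀) ^ (-2 - (n₀ : ℝ) / 2) * Real.sqrt (F (-1) t) ≤
      C₁ * (1 + ε₀) ^ (-2 - (n₀ : ℝ) / 2) * Real.sqrt E₁ := by
  have _ := h.tau_zero
  exact mul_le_mul_of_nonneg_left (Real.sqrt_le_sqrt hEm)
    (mul_nonneg hC₁ (Real.rpow_nonneg (by linarith) _))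

/-- **(6.134♯) with explicit error.** At a time `t ≥ τ_{n₀-N}` with `Ẽ₋₁(t) ≤ E₁`, `Ẽ₋₂(t) ≤ E₂`
and `|Z̃_{c,-1}(t)|, |Z̃_{d,-1}(t)| ≤ ζ` (`ε, K, C₁ ≥ 0`): `|∂ₜã₋₁ + (1+ε₀)^{-5/2}ε⁻²c̃₋₁d̃₋₁| ≤
(1+ε₀)^{-5/2}(2εE₁ + 2ε²e^{-K^{10}}E₁ + 2KE₂) + C₁(1+ε₀)^{-2-n₀/2}√E₁ + (1+ε₀)^{-5/2}ε⁻²ζ²` — the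
two-way hand-off `K(d̃²_{-2} - Z̃²_{d,-2})` from scale `-2` is bounded by `2KE₂` exactly as Tao's
`Kd²_{-2}`, so the asymmetry of the OLD shell `-2` never enters. [cite: Tao2016AveragedNS, §6.6 (6.134)] -/
theorem RescaledSplitHypotheses.eq_a_neg_one
    (h : RescaledSplitHypotheses γ ε₀ K ε C₁ C₂ C₃ n₀ N η β τ Y W F) (hε : 0 ≤ ε) (hK : 0 ≤ K)
    (hC₁ : 0 ≤ C₁) (hε₀ : -1 < ε₀) {t E₁ E₂ ζ : ℝ} (ht : τ (n₀ - N) ≤ t) (hEm : F (-1) t ≤ E₁)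
    (hEm2 : F (-2) t ≤ E₂) (hWc : |W 1 (-1) t| ≤ ζ) (hWd : |W 2 (-1) t| ≤ ζ) :
    |derivWithin (Y 0 (-1)) (Ici (τ (n₀ - N))) t +
        (1 + ε₀) ^ (-((5 : ℝ) / 2)) * (ε ^ 2)⁻¹ * Y 2 (-1) t * Y 3 (-1) t| ≤
      (1 + ε₀) ^ (-((5 : ℝ) / 2)) * (2 * ε * E₁ + 2 * ε ^ 2 * Real.exp (-K ^ 10) * E₁ + 2 * K * E₂) +
        C₁ * (1 + ε₀) ^ (-2 - (n₀ : ℝ) / 2) * Real.sqrt E₁ +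
        (1 + ε₀) ^ (-((5 : ℝ) / 2)) * (ε ^ 2)⁻¹ * ζ ^ 2 := by
  have h1 := h.eq1 (-1) t ht
  simp only [Int.reduceNeg, Int.cast_neg, Int.cast_one, mul_neg, mul_one, neg_div,
    Int.reduceSub] at h1
  have hQ : 0 < (1 + ε₀) ^ (-((5 : ℝ) / 2)) := Real.rpow_pos_of_pos (by linarith) _
  set Q := (1 + ε₀) ^ (-((5 : ℝ) / 2)) with hQdef
  have hab := h.abs_mul_le_two_mul_energy 0 1 (-1) ht
  have hac := h.abs_mul_le_two_mul_energy 0 2 (-1) ht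
  have hdd := h.abs_sq_sub_sqW_le_two_mul_energy (-2) ht
  have hcd := abs_mul_le_sq hWc hWd
  have t0 := h1.trans (h.err_neg_one_le hC₁ hε₀ hEm)
  have hE₁ : 0 ≤ E₁ := le_trans (h.nonneg_F (-1) t ht) hEm
  have key : derivWithin (Y 0 (-1)) (Ici (τ (n₀ - N))) t + Q * (ε ^ 2)⁻¹ * Y 2 (-1) t * Y 3 (-1) t =
      (derivWithin (Y 0 (-1)) (Ici (τ (n₀ - N))) t -
        Q * (-(ε ^ 2)⁻¹ * Y 2 (-1) t * Y 3 (-1) t - ε * Y 0 (-1) t * Y 1 (-1) t -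
          ε ^ 2 * Real.exp (-K ^ 10) * Y 0 (-1) t * Y 2 (-1) t + K * Y 3 (-2) t ^ 2 +
          (ε ^ 2)⁻¹ * W 1 (-1) t * W 2 (-1) t - K * W 2 (-2) t ^ 2)) +
      Q * (-(ε * (Y 0 (-1) t * Y 1 (-1) t)) - ε ^ 2 * Real.exp (-K ^ 10) * (Y 0 (-1) t * Y 2 (-1) t) +
        K * (Y 3 (-2) t ^ 2 - W 2 (-2) t ^ 2) + (ε ^ 2)⁻¹ * (W 1 (-1) t * W 2 (-1) t)) := by
    simp only [hQdef]; ring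
  rw [key]
  refine (abs_add_le _ _).trans ?_
  have t1 : |-(ε * (Y 0 (-1) t * Y 1 (-1) t))| ≤ 2 * ε * E₁ := by
    rw [abs_neg, abs_mul, abs_of_nonneg hε]; nlinarith
  have t2 : |ε ^ 2 * Real.exp (-K ^ 10) * (Y 0 (-1) t * Y 2 (-1) t)| ≤
      2 * ε ^ 2 * Real.exp (-K ^ 10) * E₁ := by
    rw [abs_mul, abs_of_nonneg (by positivity)]
    have : 0 ≤ ε ^ 2 * Real.exp (-K ^ 10) := by positivity
    nlinarith
  have t3 : |K * (Y 3 (-2) t ^ 2 - W 2 (-2) t ^ 2)| ≤ 2 * K * E₂ := by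
    rw [abs_mul, abs_of_nonneg hK]; nlinarith
  have t4 : |(ε ^ 2)⁻¹ * (W 1 (-1) t * W 2 (-1) t)| ≤ (ε ^ 2)⁻¹ * ζ ^ 2 := by
    rw [abs_mul, abs_of_nonneg (by positivity)]
    exact mul_le_mul_of_nonneg_left hcd (by positivity)
  have hs0 : |Q * (-(ε * (Y 0 (-1) t * Y 1 (-1) t)) - ε ^ 2 * Real.exp (-K ^ 10) * (Y 0 (-1) t * Y 2 (-1) t) +
        K * (Y 3 (-2) t ^ 2 - W 2 (-2) t ^ 2) + (ε ^ 2)⁻¹ * (W 1 (-1) t * W 2 (-1) t))| ≤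
      Q * (2 * ε * E₁ + 2 * ε ^ 2 * Real.exp (-K ^ 10) * E₁ + 2 * K * E₂ + (ε ^ 2)⁻¹ * ζ ^ 2) := by
    rw [abs_mul, abs_of_pos hQ]
    apply mul_le_mul_of_nonneg_left _ hQ.le
    have hs1 := abs_add_le (-(ε * (Y 0 (-1) t * Y 1 (-1) t)) -
        ε ^ 2 * Real.exp (-K ^ 10) * (Y 0 (-1) t * Y 2 (-1) t) + K * (Y 3 (-2) t ^ 2 - W 2 (-2) t ^ 2))
      ((ε ^ 2)⁻¹ * (W 1 (-1) t * W 2 (-1) t))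
    have hs2 := abs_add_le (-(ε * (Y 0 (-1) t * Y 1 (-1) t)) -
        ε ^ 2 * Real.exp (-K ^ 10) * (Y 0 (-1) t * Y 2 (-1) t)) (K * (Y 3 (-2) t ^ 2 - W 2 (-2) t ^ 2))
    have hs3 := abs_sub (-(ε * (Y 0 (-1) t * Y 1 (-1) t)))
      (ε ^ 2 * Real.exp (-K ^ 10) * (Y 0 (-1) t * Y 2 (-1) t))
    linarith
  have e1 : Q * (2 * ε * E₁ + 2 * ε ^ 2 * Real.exp (-K ^ 10) * E₁ + 2 * K * E₂ + (ε ^ 2)⁻¹ * ζ ^ 2) =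
      Q * (2 * ε * E₁ + 2 * ε ^ 2 * Real.exp (-K ^ 10) * E₁ + 2 * K * E₂) + Q * (ε ^ 2)⁻¹ * ζ ^ 2 := by
    ring
  linarith

/-- **(6.135♯) with explicit error**: `|∂ₜb̃₋₁ - (1+ε₀)^{-5/2}(εã₋₁² - ε⁻¹K^{10}c̃₋₁²)| ≤
C₁(1+ε₀)^{-2-n₀/2}√E₁ + (1+ε₀)^{-5/2}(ε + ε⁻¹K¹⁰)ζ²` when `Ẽ₋₁(t) ≤ E₁` and `|Z̃_{a,-1}|, |Z̃_{c,-1}| ≤ ζ`.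
[cite: Tao2016AveragedNS, §6.6 (6.135)] -/
theorem RescaledSplitHypotheses.eq_b_neg_one
    (h : RescaledSplitHypotheses γ ε₀ K ε C₁ C₂ C₃ n₀ N η β τ Y W F) (hε : 0 ≤ ε) (hC₁ : 0 ≤ C₁)
    (hε₀ : -1 < ε₀) {t E₁ ζ : ℝ} (ht : τ (n₀ - N) ≤ t) (hEm : F (-1) t ≤ E₁)
    (hWa : |W 0 (-1) t| ≤ ζ) (hWc : |W 1 (-1) t| ≤ ζ) :
    |derivWithin (Y 1 (-1)) (Ici (τ (n₀ - N))) t -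
        (1 + ε₀) ^ (-((5 : ℝ) / 2)) * (ε * Y 0 (-1) t ^ 2 - ε⁻¹ * K ^ 10 * Y 2 (-1) t ^ 2)| ≤
      C₁ * (1 + ε₀) ^ (-2 - (n₀ : ℝ) / 2) * Real.sqrt E₁ +
        (1 + ε₀) ^ (-((5 : ℝ) / 2)) * (ε + ε⁻¹ * K ^ 10) * ζ ^ 2 := by
  have h2 := h.eq2 (-1) t ht
  simp only [Int.reduceNeg, Int.cast_neg, Int.cast_one, mul_neg, mul_one, neg_div] at h2
  have hQ : 0 < (1 + ε₀) ^ (-((5 : ℝ) / 2)) := Real.rpow_pos_of_pos (by linarith) _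
  set Q := (1 + ε₀) ^ (-((5 : ℝ) / 2)) with hQdef
  have t0 := h2.trans (h.err_neg_one_le hC₁ hε₀ hEm)
  have ha := sq_le_sq_of_abs_le hWa
  have hc := sq_le_sq_of_abs_le hWc
  have key : derivWithin (Y 1 (-1)) (Ici (τ (n₀ - N))) t -
      Q * (ε * Y 0 (-1) t ^ 2 - ε⁻¹ * K ^ 10 * Y 2 (-1) t ^ 2) =
      (derivWithin (Y 1 (-1)) (Ici (τ (n₀ - N))) t -
        Q * (ε * Y 0 (-1) t ^ 2 - ε⁻¹ * K ^ 10 * Y 2 (-1) t ^ 2 - ε * W 0 (-1) t ^ 2 +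
          ε⁻¹ * K ^ 10 * W 1 (-1) t ^ 2)) +
      Q * (-(ε * W 0 (-1) t ^ 2) + ε⁻¹ * K ^ 10 * W 1 (-1) t ^ 2) := by
    simp only [hQdef]; ring
  rw [key]
  refine (abs_add_le _ _).trans ?_
  have hK10 : 0 ≤ ε⁻¹ * K ^ 10 := by positivity
  have inner : |-(ε * W 0 (-1) t ^ 2) + ε⁻¹ * K ^ 10 * W 1 (-1) t ^ 2| ≤
      (ε + ε⁻¹ * K ^ 10) * ζ ^ 2 := by
    refine (abs_add_le _ _).trans ?_
    rw [abs_neg, abs_of_nonneg (by positivity), abs_of_nonneg (by positivity)]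
    nlinarith [mul_le_mul_of_nonneg_left ha hε, mul_le_mul_of_nonneg_left hc hK10]
  have t1 : |Q * (-(ε * W 0 (-1) t ^ 2) + ε⁻¹ * K ^ 10 * W 1 (-1) t ^ 2)| ≤
      Q * (ε + ε⁻¹ * K ^ 10) * ζ ^ 2 := by
    calc |Q * (-(ε * W 0 (-1) t ^ 2) + ε⁻¹ * K ^ 10 * W 1 (-1) t ^ 2)|
        = Q * |-(ε * W 0 (-1) t ^ 2) + ε⁻¹ * K ^ 10 * W 1 (-1) t ^ 2| := by
          rw [abs_mul, abs_of_pos hQ]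
      _ ≤ Q * ((ε + ε⁻¹ * K ^ 10) * ζ ^ 2) := mul_le_mul_of_nonneg_left inner hQ.le
      _ = Q * (ε + ε⁻¹ * K ^ 10) * ζ ^ 2 := by ring
  linarith

/-- **(6.136♯) with explicit error**: `|∂ₜc̃₋₁ - (1+ε₀)^{-5/2}(ε²e^{-K^{10}}ã₋₁² + ε⁻¹K^{10}b̃₋₁c̃₋₁)| ≤
C₁(1+ε₀)^{-2-n₀/2}√E₁ + (1+ε₀)^{-5/2}ε²e^{-K¹⁰}ζ²` when `Ẽ₋₁(t) ≤ E₁` and `|Z̃_{a,-1}| ≤ ζ`.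
[cite: Tao2016AveragedNS, §6.6 (6.136)] -/
theorem RescaledSplitHypotheses.eq_c_neg_one
    (h : RescaledSplitHypotheses γ ε₀ K ε C₁ C₂ C₃ n₀ N η β τ Y W F) (hC₁ : 0 ≤ C₁) (hε₀ : -1 < ε₀)
    {t E₁ ζ : ℝ} (ht : τ (n₀ - N) ≤ t) (hEm : F (-1) t ≤ E₁) (hWa : |W 0 (-1) t| ≤ ζ) :
    |derivWithin (Y 2 (-1)) (Ici (τ (n₀ - N))) t -
        (1 + ε₀) ^ (-((5 : ℝ) / 2)) *
          (ε ^ 2 * Real.exp (-K ^ 10) * Y 0 (-1) t ^ 2 + ε⁻¹ * K ^ 10 * Y 1 (-1) t * Y 2 (-1) t)| ≤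
      C₁ * (1 + ε₀) ^ (-2 - (n₀ : ℝ) / 2) * Real.sqrt E₁ +
        (1 + ε₀) ^ (-((5 : ℝ) / 2)) * (ε ^ 2 * Real.exp (-K ^ 10)) * ζ ^ 2 := by
  have h3 := h.eq3 (-1) t ht
  simp only [Int.reduceNeg, Int.cast_neg, Int.cast_one, mul_neg, mul_one, neg_div] at h3
  have hQ : 0 < (1 + ε₀) ^ (-((5 : ℝ) / 2)) := Real.rpow_pos_of_pos (by linarith) _
  set Q := (1 + ε₀) ^ (-((5 : ℝ) / 2)) with hQdef
  have t0 := h3.trans (h.err_neg_one_le hC₁ hε₀ hEm)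
  have ha := sq_le_sq_of_abs_le hWa
  have key : derivWithin (Y 2 (-1)) (Ici (τ (n₀ - N))) t -
      Q * (ε ^ 2 * Real.exp (-K ^ 10) * Y 0 (-1) t ^ 2 + ε⁻¹ * K ^ 10 * Y 1 (-1) t * Y 2 (-1) t) =
      (derivWithin (Y 2 (-1)) (Ici (τ (n₀ - N))) t -
        Q * (ε ^ 2 * Real.exp (-K ^ 10) * Y 0 (-1) t ^ 2 + ε⁻¹ * K ^ 10 * Y 1 (-1) t * Y 2 (-1) t -
          ε ^ 2 * Real.exp (-K ^ 10) * W 0 (-1) t ^ 2)) +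
      -(Q * (ε ^ 2 * Real.exp (-K ^ 10)) * W 0 (-1) t ^ 2) := by
    simp only [hQdef]; ring
  rw [key]
  refine (abs_add_le _ _).trans ?_
  have hl : 0 ≤ Q * (ε ^ 2 * Real.exp (-K ^ 10)) := by positivity
  have t1 : |-(Q * (ε ^ 2 * Real.exp (-K ^ 10)) * W 0 (-1) t ^ 2)| ≤
      Q * (ε ^ 2 * Real.exp (-K ^ 10)) * ζ ^ 2 := by
    rw [abs_neg, abs_of_nonneg (by positivity)]
    exact mul_le_mul_of_nonneg_left ha hl
  linarith

/-- **(6.137♯) with explicit error**: `|∂ₜd̃₋₁ - ((1+ε₀)^{-5/2}ε⁻²c̃₋₁ã₋₁ - Kd̃₋₁ã₀)| ≤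
C₁(1+ε₀)^{-2-n₀/2}√E₁ + (1+ε₀)^{-5/2}ε⁻²ζ²` when `Ẽ₋₁(t) ≤ E₁` and `|Z̃_{a,-1}|, |Z̃_{c,-1}| ≤ ζ` (the
prefactors `(1+ε₀)^{∓5/2}` of the coupling to `ã₀` cancel). [cite: Tao2016AveragedNS, §6.6 (6.137)] -/
theorem RescaledSplitHypotheses.eq_d_neg_one
    (h : RescaledSplitHypotheses γ ε₀ K ε C₁ C₂ C₃ n₀ N η β τ Y W F) (hC₁ : 0 ≤ C₁) (hε₀ : -1 < ε₀)
    {t E₁ ζ : ℝ} (ht : τ (n₀ - N) ≤ t) (hEm : F (-1) t ≤ E₁) (hWa : |W 0 (-1) t| ≤ ζ)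
    (hWc : |W 1 (-1) t| ≤ ζ) :
    |derivWithin (Y 3 (-1)) (Ici (τ (n₀ - N))) t -
        ((1 + ε₀) ^ (-((5 : ℝ) / 2)) * (ε ^ 2)⁻¹ * Y 2 (-1) t * Y 0 (-1) t -
          K * Y 3 (-1) t * Y 0 0 t)| ≤
      C₁ * (1 + ε₀) ^ (-2 - (n₀ : ℝ) / 2) * Real.sqrt E₁ +
        (1 + ε₀) ^ (-((5 : ℝ) / 2)) * (ε ^ 2)⁻¹ * ζ ^ 2 := by
  have h4 := h.eq4 (-1) t ht
  simp only [Int.reduceNeg, Int.cast_neg, Int.cast_one, mul_neg, mul_one, neg_div,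
    Int.reduceAdd] at h4
  have h0 : (0 : ℝ) < 1 + ε₀ := by linarith
  have hQ : 0 < (1 + ε₀) ^ (-((5 : ℝ) / 2)) := Real.rpow_pos_of_pos h0 _
  have hcancel : (1 + ε₀) ^ (-((5 : ℝ) / 2)) * (1 + ε₀) ^ ((5 : ℝ) / 2) = 1 := by
    rw [← Real.rpow_add h0]; norm_num
  set Q := (1 + ε₀) ^ (-((5 : ℝ) / 2)) with hQdef
  set P := (1 + ε₀) ^ ((5 : ℝ) / 2) with hPdef
  have t0 := h4.trans (h.err_neg_one_le hC₁ hε₀ hEm)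
  have hac := abs_mul_le_sq hWa hWc
  have key : derivWithin (Y 3 (-1)) (Ici (τ (n₀ - N))) t -
      (Q * (ε ^ 2)⁻¹ * Y 2 (-1) t * Y 0 (-1) t - K * Y 3 (-1) t * Y 0 0 t) =
      (derivWithin (Y 3 (-1)) (Ici (τ (n₀ - N))) t -
        Q * ((ε ^ 2)⁻¹ * Y 2 (-1) t * Y 0 (-1) t - P * K * Y 3 (-1) t * Y 0 0 t -
          (ε ^ 2)⁻¹ * W 0 (-1) t * W 1 (-1) t)) +
      (-(Q * (ε ^ 2)⁻¹ * (W 0 (-1) t * W 1 (-1) t)) -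
        (Q * P - 1) * (K * Y 3 (-1) t * Y 0 0 t)) := by
    simp only [hQdef, hPdef]; ring
  rw [hcancel, sub_self, zero_mul, sub_zero] at key
  rw [key]
  refine (abs_add_le _ _).trans ?_
  have t1 : |-(Q * (ε ^ 2)⁻¹ * (W 0 (-1) t * W 1 (-1) t))| ≤ Q * (ε ^ 2)⁻¹ * ζ ^ 2 := by
    rw [abs_neg, abs_mul, abs_of_nonneg (by positivity : (0 : ℝ) ≤ Q * (ε ^ 2)⁻¹)]
    exact mul_le_mul_of_nonneg_left hac (by positivity)
  linarith

/-- **The energy inequality (6.49♯) at scale `-1` with the input term bounded** ((6.177♯):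
"`∂ₜẼ₋₁ ≤ -Kd₋₁²a₀ + O(K^{-14})`"): when `Ẽ₋₁(t) ≤ E₁`, `Ẽ₋₂(t) ≤ E₂` and `|Z̃_{d,-1}(t)| ≤ ζ`
(`K ≥ 0`), `∂ₜẼ₋₁ ≤ -K d̃₋₁² ã₀ + 2K(1+ε₀)^{-5/2} E₂ √(2E₁) + K ζ² |ã₀|` (the outflow to scale `0`
reads `-K(d̃²₋₁ - Z̃²_{d,-1})ã₀`). [cite: Tao2016AveragedNS, §6.7 (6.177)] -/
theorem RescaledSplitHypotheses.energy_neg_one_deriv_le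
    (h : RescaledSplitHypotheses γ ε₀ K ε C₁ C₂ C₃ n₀ N η β τ Y W F) (hK : 0 ≤ K) (hε₀ : -1 < ε₀)
    {t E₁ E₂ ζ : ℝ} (ht : τ (n₀ - N) ≤ t) (hEm : F (-1) t ≤ E₁) (hEm2 : F (-2) t ≤ E₂)
    (hWd : |W 2 (-1) t| ≤ ζ) :
    derivWithin (F (-1)) (Ici (τ (n₀ - N))) t ≤
      -(K * Y 3 (-1) t ^ 2 * Y 0 0 t) +
        2 * K * (1 + ε₀) ^ (-((5 : ℝ) / 2)) * E₂ * Real.sqrt (2 * E₁) + K * ζ ^ 2 * |Y 0 0 t| := by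
  have hen := h.energy (-1) t ht
  simp only [Int.reduceNeg, Int.cast_neg, Int.cast_one, mul_neg, mul_one, neg_div,
    Int.reduceSub, Int.reduceAdd] at hen
  have h0 : (0 : ℝ) < 1 + ε₀ := by linarith
  have hQ : 0 < (1 + ε₀) ^ (-((5 : ℝ) / 2)) := Real.rpow_pos_of_pos h0 _
  have hcancel : (1 + ε₀) ^ (-((5 : ℝ) / 2)) * (1 + ε₀) ^ ((5 : ℝ) / 2) = 1 := by
    rw [← Real.rpow_add h0]; norm_num
  have hdd := h.abs_sq_sub_sqW_le_two_mul_energy (-2) ht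
  have hd1 := sq_le_sq_of_abs_le hWd
  have ha : |Y 0 (-1) t| ≤ Real.sqrt (2 * E₁) :=
    (h.abs_le_sqrt_energy 0 (-1) ht).trans (Real.sqrt_le_sqrt (by linarith))
  have hE2 : 0 ≤ E₂ := by
    have := (abs_nonneg _).trans hdd
    linarith
  have t1 : (Y 3 (-2) t ^ 2 - W 2 (-2) t ^ 2) * Y 0 (-1) t ≤ 2 * E₂ * Real.sqrt (2 * E₁) := by
    calc (Y 3 (-2) t ^ 2 - W 2 (-2) t ^ 2) * Y 0 (-1) t
        ≤ |Y 3 (-2) t ^ 2 - W 2 (-2) t ^ 2| * |Y 0 (-1) t| := by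
          rw [← abs_mul]; exact le_abs_self _
      _ ≤ (2 * E₂) * Real.sqrt (2 * E₁) :=
          mul_le_mul (hdd.trans (by linarith)) ha (abs_nonneg _) (by positivity)
  have t2 : K * W 2 (-1) t ^ 2 * Y 0 0 t ≤ K * ζ ^ 2 * |Y 0 0 t| := by
    calc K * W 2 (-1) t ^ 2 * Y 0 0 t ≤ K * W 2 (-1) t ^ 2 * |Y 0 0 t| :=
          mul_le_mul_of_nonneg_left (le_abs_self _) (by positivity)
      _ ≤ K * ζ ^ 2 * |Y 0 0 t| := by
          apply mul_le_mul_of_nonneg_right _ (abs_nonneg _)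
          exact mul_le_mul_of_nonneg_left hd1 hK
  calc derivWithin (F (-1)) (Ici (τ (n₀ - N))) t
      ≤ K * (1 + ε₀) ^ (-((5 : ℝ) / 2)) *
          ((Y 3 (-2) t ^ 2 - W 2 (-2) t ^ 2) * Y 0 (-1) t -
            (1 + ε₀) ^ ((5 : ℝ) / 2) * (Y 3 (-1) t ^ 2 - W 2 (-1) t ^ 2) * Y 0 0 t) := hen
    _ = K * (1 + ε₀) ^ (-((5 : ℝ) / 2)) * ((Y 3 (-2) t ^ 2 - W 2 (-2) t ^ 2) * Y 0 (-1) t) -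
          ((1 + ε₀) ^ (-((5 : ℝ) / 2)) * (1 + ε₀) ^ ((5 : ℝ) / 2)) *
            (K * Y 3 (-1) t ^ 2 * Y 0 0 t) +
          ((1 + ε₀) ^ (-((5 : ℝ) / 2)) * (1 + ε₀) ^ ((5 : ℝ) / 2)) *
            (K * W 2 (-1) t ^ 2 * Y 0 0 t) := by ring
    _ = K * (1 + ε₀) ^ (-((5 : ℝ) / 2)) * ((Y 3 (-2) t ^ 2 - W 2 (-2) t ^ 2) * Y 0 (-1) t) -
          K * Y 3 (-1) t ^ 2 * Y 0 0 t + K * W 2 (-1) t ^ 2 * Y 0 0 t := by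
        rw [hcancel]; ring
    _ ≤ _ := by
        have : K * (1 + ε₀) ^ (-((5 : ℝ) / 2)) * ((Y 3 (-2) t ^ 2 - W 2 (-2) t ^ 2) * Y 0 (-1) t) ≤
            K * (1 + ε₀) ^ (-((5 : ℝ) / 2)) * (2 * E₂ * Real.sqrt (2 * E₁)) :=
          mul_le_mul_of_nonneg_left t1 (by positivity)
        nlinarith

end CoarseModes

section ZRows

variable {γ ε₀ K ε C₁ C₂ C₃ : ℝ} {n₀ N : ℤ} {η : ℤ → ℝ} {β : ℕ → ℝ} {τ : ℤ → ℝ}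
  {Y : Fin 4 → ℤ → ℝ → ℝ} {W : Fin 3 → ℤ → ℝ → ℝ} {F : ℤ → ℝ → ℝ}

/-! ## The asymmetry rows (6.Z1)–(6.Z3) at scales `-1, 0, 1` with explicit errors

These are the inputs of the channel lemmas of `SplitCascadeChannels.lean` (clock channel on
`Z̃_c`, neutral rotor + hand-off growth on `(Z̃_a, Z̃_d)`) inside the bootstrap window: the same
dissipation-class error as the symmetric rows, here playing the role of the asymmetry SOURCE. -/

/-- **(6.Z1) at scale `0` with explicit error**: when `Ẽ₀(t) ≤ 1`,
`|∂ₜZ̃_{a,0} - (εb̃₀Z̃_{a,0} + ε²e^{-K¹⁰}c̃₀Z̃_{a,0} - ε⁻²c̃₀Z̃_{d,0} + ε⁻²d̃₀Z̃_{c,0})| ≤ C₁(1+ε₀)^{-n₀/2}`.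
[cite: Tao2016AveragedNS, §6.4 (6.45)] -/
theorem RescaledSplitHypotheses.eqZ_a_zero
    (h : RescaledSplitHypotheses γ ε₀ K ε C₁ C₂ C₃ n₀ N η β τ Y W F) (hC₁ : 0 ≤ C₁) (hε₀ : -1 < ε₀)
    {t : ℝ} (ht : τ (n₀ - N) ≤ t) (hE0 : F 0 t ≤ 1) :
    |derivWithin (W 0 0) (Ici (τ (n₀ - N))) t -
        (ε * Y 1 0 t * W 0 0 t + ε ^ 2 * Real.exp (-K ^ 10) * Y 2 0 t * W 0 0 t -
          (ε ^ 2)⁻¹ * Y 2 0 t * W 2 0 t + (ε ^ 2)⁻¹ * Y 3 0 t * W 1 0 t)| ≤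
      C₁ * (1 + ε₀) ^ (-((n₀ : ℝ) / 2)) := by
  have hz := h.eqZ1 0 t ht
  simp only [Int.cast_zero, mul_zero, zero_div, Real.rpow_zero, one_mul, zero_sub] at hz
  exact hz.trans (h.err_zero_le hC₁ hε₀ hE0)

/-- **(6.Z2) at scale `0` with explicit error** (the clock channel): when `Ẽ₀(t) ≤ 1`,
`|∂ₜZ̃_{c,0} + ε⁻¹K¹⁰ b̃₀ Z̃_{c,0}| ≤ C₁(1+ε₀)^{-n₀/2}` — damped while `b̃₀ ≥ 0`.
[cite: Tao2016AveragedNS, §6.4 (6.47)] -/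
theorem RescaledSplitHypotheses.eqZ_c_zero
    (h : RescaledSplitHypotheses γ ε₀ K ε C₁ C₂ C₃ n₀ N η β τ Y W F) (hC₁ : 0 ≤ C₁) (hε₀ : -1 < ε₀)
    {t : ℝ} (ht : τ (n₀ - N) ≤ t) (hE0 : F 0 t ≤ 1) :
    |derivWithin (W 1 0) (Ici (τ (n₀ - N))) t + ε⁻¹ * K ^ 10 * Y 1 0 t * W 1 0 t| ≤
      C₁ * (1 + ε₀) ^ (-((n₀ : ℝ) / 2)) := by
  have hz := h.eqZ2 0 t ht
  simp only [Int.cast_zero, mul_zero, zero_div, Real.rpow_zero, one_mul, zero_sub,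
    sub_neg_eq_add] at hz
  exact hz.trans (h.err_zero_le hC₁ hε₀ hE0)

/-- **(6.Z3) at scale `0` with explicit error** (rotor + hand-off growth): when `Ẽ₀(t) ≤ 1`,
`|∂ₜZ̃_{d,0} - (ε⁻²c̃₀Z̃_{a,0} - ε⁻²ã₀Z̃_{c,0} + (1+ε₀)^{5/2}K ã₁ Z̃_{d,0})| ≤ C₁(1+ε₀)^{-n₀/2}`.
[cite: Tao2016AveragedNS, §6.4 (6.48)] -/
theorem RescaledSplitHypotheses.eqZ_d_zero
    (h : RescaledSplitHypotheses γ ε₀ K ε C₁ C₂ C₃ n₀ N η β τ Y W F) (hC₁ : 0 ≤ C₁) (hε₀ : -1 < ε₀)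
    {t : ℝ} (ht : τ (n₀ - N) ≤ t) (hE0 : F 0 t ≤ 1) :
    |derivWithin (W 2 0) (Ici (τ (n₀ - N))) t -
        ((ε ^ 2)⁻¹ * Y 2 0 t * W 0 0 t - (ε ^ 2)⁻¹ * Y 0 0 t * W 1 0 t +
          (1 + ε₀) ^ ((5 : ℝ) / 2) * K * Y 0 1 t * W 2 0 t)| ≤
      C₁ * (1 + ε₀) ^ (-((n₀ : ℝ) / 2)) := by
  have hz := h.eqZ3 0 t ht
  simp only [Int.cast_zero, mul_zero, zero_div, Real.rpow_zero, one_mul, zero_sub, zero_add] at hz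
  exact hz.trans (h.err_zero_le hC₁ hε₀ hE0)

/-- **(6.Z1) at scale `1`**: `|∂ₜZ̃_{a,1} - (1+ε₀)^{5/2}(εb̃₁Z̃_{a,1} + ε²e^{-K¹⁰}c̃₁Z̃_{a,1} - ε⁻²c̃₁Z̃_{d,1} +
ε⁻²d̃₁Z̃_{c,1})| ≤ C₁(1+ε₀)^{2-n₀/2}√Ẽ₁`. [cite: Tao2016AveragedNS, §6.4 (6.45)] -/
theorem RescaledSplitHypotheses.eqZ_a_one
    (h : RescaledSplitHypotheses γ ε₀ K ε C₁ C₂ C₃ n₀ N η β τ Y W F) {t : ℝ} (ht : τ (n₀ - N) ≤ t) :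
    |derivWithin (W 0 1) (Ici (τ (n₀ - N))) t - (1 + ε₀) ^ ((5 : ℝ) / 2) *
        (ε * Y 1 1 t * W 0 1 t + ε ^ 2 * Real.exp (-K ^ 10) * Y 2 1 t * W 0 1 t -
          (ε ^ 2)⁻¹ * Y 2 1 t * W 2 1 t + (ε ^ 2)⁻¹ * Y 3 1 t * W 1 1 t)| ≤
      C₁ * (1 + ε₀) ^ (2 - (n₀ : ℝ) / 2) * Real.sqrt (F 1 t) := by
  have hz := h.eqZ1 1 t ht
  simpa only [Int.cast_one, mul_one] using hz

/-- **(6.Z2) at scale `1`** (clock channel of the fresh shell):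
`|∂ₜZ̃_{c,1} + (1+ε₀)^{5/2}ε⁻¹K¹⁰ b̃₁ Z̃_{c,1}| ≤ C₁(1+ε₀)^{2-n₀/2}√Ẽ₁`. [cite: Tao2016AveragedNS, §6.4 (6.47)] -/
theorem RescaledSplitHypotheses.eqZ_c_one
    (h : RescaledSplitHypotheses γ ε₀ K ε C₁ C₂ C₃ n₀ N η β τ Y W F) {t : ℝ} (ht : τ (n₀ - N) ≤ t) :
    |derivWithin (W 1 1) (Ici (τ (n₀ - N))) t +
        (1 + ε₀) ^ ((5 : ℝ) / 2) * (ε⁻¹ * K ^ 10 * Y 1 1 t * W 1 1 t)| ≤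
      C₁ * (1 + ε₀) ^ (2 - (n₀ : ℝ) / 2) * Real.sqrt (F 1 t) := by
  have hz := h.eqZ2 1 t ht
  simpa only [Int.cast_one, mul_one, mul_neg, sub_neg_eq_add] using hz

/-- **(6.Z3) at scale `1`**: `|∂ₜZ̃_{d,1} - (1+ε₀)^{5/2}(ε⁻²c̃₁Z̃_{a,1} - ε⁻²ã₁Z̃_{c,1} + (1+ε₀)^{5/2}Kã₂Z̃_{d,1})| ≤
C₁(1+ε₀)^{2-n₀/2}√Ẽ₁`. [cite: Tao2016AveragedNS, §6.4 (6.48)] -/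
theorem RescaledSplitHypotheses.eqZ_d_one
    (h : RescaledSplitHypotheses γ ε₀ K ε C₁ C₂ C₃ n₀ N η β τ Y W F) {t : ℝ} (ht : τ (n₀ - N) ≤ t) :
    |derivWithin (W 2 1) (Ici (τ (n₀ - N))) t - (1 + ε₀) ^ ((5 : ℝ) / 2) *
        ((ε ^ 2)⁻¹ * Y 2 1 t * W 0 1 t - (ε ^ 2)⁻¹ * Y 0 1 t * W 1 1 t +
          (1 + ε₀) ^ ((5 : ℝ) / 2) * K * Y 0 2 t * W 2 1 t)| ≤
      C₁ * (1 + ε₀) ^ (2 - (n₀ : ℝ) / 2) * Real.sqrt (F 1 t) := by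
  have hz := h.eqZ3 1 t ht
  simpa only [Int.cast_one, mul_one, Int.reduceAdd] using hz

/-- **(6.Z1) at scale `-1` with explicit error**: when `Ẽ₋₁(t) ≤ E₁`,
`|∂ₜZ̃_{a,-1} - (1+ε₀)^{-5/2}(εb̃₋₁Z̃_{a,-1} + ε²e^{-K¹⁰}c̃₋₁Z̃_{a,-1} - ε⁻²c̃₋₁Z̃_{d,-1} + ε⁻²d̃₋₁Z̃_{c,-1})| ≤
C₁(1+ε₀)^{-2-n₀/2}√E₁`. [cite: Tao2016AveragedNS, §6.4 (6.45)] -/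
theorem RescaledSplitHypotheses.eqZ_a_neg_one
    (h : RescaledSplitHypotheses γ ε₀ K ε C₁ C₂ C₃ n₀ N η β τ Y W F) (hC₁ : 0 ≤ C₁) (hε₀ : -1 < ε₀)
    {t E₁ : ℝ} (ht : τ (n₀ - N) ≤ t) (hEm : F (-1) t ≤ E₁) :
    |derivWithin (W 0 (-1)) (Ici (τ (n₀ - N))) t - (1 + ε₀) ^ (-((5 : ℝ) / 2)) *
        (ε * Y 1 (-1) t * W 0 (-1) t + ε ^ 2 * Real.exp (-K ^ 10) * Y 2 (-1) t * W 0 (-1) t -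
          (ε ^ 2)⁻¹ * Y 2 (-1) t * W 2 (-1) t + (ε ^ 2)⁻¹ * Y 3 (-1) t * W 1 (-1) t)| ≤
      C₁ * (1 + ε₀) ^ (-2 - (n₀ : ℝ) / 2) * Real.sqrt E₁ := by
  have hz := h.eqZ1 (-1) t ht
  simp only [Int.reduceNeg, Int.cast_neg, Int.cast_one, mul_neg, mul_one, neg_div] at hz
  exact hz.trans (h.err_neg_one_le hC₁ hε₀ hEm)

/-- **(6.Z2) at scale `-1` with explicit error** (clock channel of the previous shell, whose clock
`b̃₋₁ ≥ 10⁻⁵ε` is positive, so `Z̃_{c,-1}` is DAMPED):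
`|∂ₜZ̃_{c,-1} + (1+ε₀)^{-5/2}ε⁻¹K¹⁰ b̃₋₁ Z̃_{c,-1}| ≤ C₁(1+ε₀)^{-2-n₀/2}√E₁` when `Ẽ₋₁(t) ≤ E₁`.
[cite: Tao2016AveragedNS, §6.4 (6.47)] -/
theorem RescaledSplitHypotheses.eqZ_c_neg_one
    (h : RescaledSplitHypotheses γ ε₀ K ε C₁ C₂ C₃ n₀ N η β τ Y W F) (hC₁ : 0 ≤ C₁) (hε₀ : -1 < ε₀)
    {t E₁ : ℝ} (ht : τ (n₀ - N) ≤ t) (hEm : F (-1) t ≤ E₁) :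
    |derivWithin (W 1 (-1)) (Ici (τ (n₀ - N))) t +
        (1 + ε₀) ^ (-((5 : ℝ) / 2)) * (ε⁻¹ * K ^ 10 * Y 1 (-1) t * W 1 (-1) t)| ≤
      C₁ * (1 + ε₀) ^ (-2 - (n₀ : ℝ) / 2) * Real.sqrt E₁ := by
  have hz := h.eqZ2 (-1) t ht
  simp only [Int.reduceNeg, Int.cast_neg, Int.cast_one, mul_neg, mul_one, neg_div,
    sub_neg_eq_add] at hz
  exact hz.trans (h.err_neg_one_le hC₁ hε₀ hEm)

/-- **(6.Z3) at scale `-1` with explicit error** (the hand-off channel of the previous shell: GROWTH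
at rate `K ã₀`, the prefactors `(1+ε₀)^{∓5/2}` cancelling): when `Ẽ₋₁(t) ≤ E₁`,
`|∂ₜZ̃_{d,-1} - ((1+ε₀)^{-5/2}ε⁻²(c̃₋₁Z̃_{a,-1} - ã₋₁Z̃_{c,-1}) + K ã₀ Z̃_{d,-1})| ≤ C₁(1+ε₀)^{-2-n₀/2}√E₁`.
[cite: Tao2016AveragedNS, §6.4 (6.48)] -/
theorem RescaledSplitHypotheses.eqZ_d_neg_one
    (h : RescaledSplitHypotheses γ ε₀ K ε C₁ C₂ C₃ n₀ N η β τ Y W F) (hC₁ : 0 ≤ C₁) (hε₀ : -1 < ε₀)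
    {t E₁ : ℝ} (ht : τ (n₀ - N) ≤ t) (hEm : F (-1) t ≤ E₁) :
    |derivWithin (W 2 (-1)) (Ici (τ (n₀ - N))) t -
        ((1 + ε₀) ^ (-((5 : ℝ) / 2)) * (ε ^ 2)⁻¹ * (Y 2 (-1) t * W 0 (-1) t - Y 0 (-1) t * W 1 (-1) t) +
          K * Y 0 0 t * W 2 (-1) t)| ≤
      C₁ * (1 + ε₀) ^ (-2 - (n₀ : ℝ) / 2) * Real.sqrt E₁ := by
  have hz := h.eqZ3 (-1) t ht
  simp only [Int.reduceNeg, Int.cast_neg, Int.cast_one, mul_neg, mul_one, neg_div,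
    Int.reduceAdd] at hz
  have h0 : (0 : ℝ) < 1 + ε₀ := by linarith
  have hcancel : (1 + ε₀) ^ (-((5 : ℝ) / 2)) * (1 + ε₀) ^ ((5 : ℝ) / 2) = 1 := by
    rw [← Real.rpow_add h0]; norm_num
  have key : (1 + ε₀) ^ (-((5 : ℝ) / 2)) * (ε ^ 2)⁻¹ * (Y 2 (-1) t * W 0 (-1) t - Y 0 (-1) t * W 1 (-1) t) +
        K * Y 0 0 t * W 2 (-1) t =
      (1 + ε₀) ^ (-((5 : ℝ) / 2)) *
        ((ε ^ 2)⁻¹ * Y 2 (-1) t * W 0 (-1) t - (ε ^ 2)⁻¹ * Y 0 (-1) t * W 1 (-1) t +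
          (1 + ε₀) ^ ((5 : ℝ) / 2) * K * Y 0 0 t * W 2 (-1) t) := by
    have : K * Y 0 0 t * W 2 (-1) t =
        ((1 + ε₀) ^ (-((5 : ℝ) / 2)) * (1 + ε₀) ^ ((5 : ℝ) / 2)) * (K * Y 0 0 t * W 2 (-1) t) := by
      rw [hcancel, one_mul]
    rw [this]; ring
  rw [key]
  exact hz.trans (h.err_neg_one_le hC₁ hε₀ hEm)

end ZRows

end Literature.Analysis.FluidPDE.Tao2016AveragedNS
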